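import Mathlib.Algebra.MvPolynomial.Rename
import Mathlib.Algebra.MvPolynomial.Monad
import Mathlib.Data.List.GetD
import Mathlib.Data.ENat.Basic
import Mathlib.Tactic.DeriveFintype
import HarnessLib

/-!
# Equational proof systems for polynomial identities: `P_f(𝔽)` and `P_c(𝔽)` (Hrubeš–Tzameret)

Definition item `defn-PIProof` (route ValiantsHypothesis/ProofCarryingSymmetry).

P. Hrubeš, I. Tzameret, *Short proofs for the determinant identities*, SIAM J. Comput. 44
(2015) = arXiv:1112.6265, §1.1 "Arithmetic proofs with circuits and formulas" (locators below
follow the arXiv version; the systems go back to Hrubeš–Tzameret, CCC 2009, Def. of `P(R)`):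

* **Circuits and formulas.** An arithmetic circuit is a finite DAG whose in-degree-`0` nodes are
  labelled by a variable or a field element and whose other nodes have in-degree two, are
  labelled `+` or `×`, with the two in-edges labelled left/right; one output node. A formula is
  a circuit in which every node has out-degree one (a tree). The SIZE of a circuit is its number
  of nodes, the DEPTH the length of a longest directed path. `F_u` is the subcircuit of `F` with
  output node `u`; `F ⊕ G` (`F ⊗ G`) is any circuit whose output node is `u + v` (`u · v`) with
  `F_u = F`, `F_v = G` (possibly sharing nodes); `F + G` (`F · G`) is `F' ⊕ G'` (`F' ⊗ G'`) on
  DISJOINT copies. `F̂ ∈ 𝔽[X]` is the computed polynomial; `F(z/H)` substitutes a disjoint copy of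
  `H` for every node labelled `z`.
* **`P_f(𝔽)`** proves equations `F = G` between formulas. Rules: R1 `F = G ⊢ G = F`;
  R2 `F = G, G = H ⊢ F = H`; R3 `F₁ = G₁, F₂ = G₂ ⊢ F₁ + F₂ = G₁ + G₂`; R4 the same for `·`.
  Axioms (schemes; `F, G, H` formulas): A1 `F = F`; A2 `F + G = G + F`; A3 `F + (G + H) = (F + G) + H`;
  A4 `F·G = G·F`; A5 `F·(G·H) = (F·G)·H`; A6 `F·(G + H) = F·G + F·H`; A7 `F + 0 = F`; A8 `F·0 = 0`;
  A9 `F·1 = F`; A10 `a = b + c`, `a' = b'·c'` whenever these hold in `𝔽`. A proof is a sequence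
  of equations each of which is an axiom or obtained from PREVIOUS equations by a rule; its size
  is the sum of the sizes of all `F_i` and `G_i`, its number of lines is its length.
* **`P_c(𝔽)`** is the same with `F, G, H, F_i, G_i` ranging over circuits, plus the axioms
  C1 `F₁ ⊕ F₂ = F₁ + F₂` and C2 `F₁ ⊗ F₂ = F₁ · F₂`; the depth of a `P_c` proof is the maximal
  depth of a circuit in it.
* Prop. 1.1 (soundness and completeness: provable iff `F̂ = Ĝ`), Prop. 1.2 (`P_c ≡_p EP_f`;
  `k` lines on size-`s` circuits ⇒ a proof of size `poly(s,k)`), Remark 1.3 (A1, C1, C2 may be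
  replaced by A1' `F = G` whenever `F` and `G` unfold to the same formula), and "proofs are
  closed under substitution".

## Lean rendering

* `PIAxiom`: the twelve axiom schemes A1–A10, C1, C2 (A10 covers both constant equations).
* `PIFormula 𝔽 X`: formulas as the inductive type of binary `+/×` trees with leaves `var x`,
  `const c` — literally HT's formulas (left/right order = argument order). `size` = number of
  nodes (HT), `depth`, `eval : MvPolynomial X 𝔽`, `rename`, simultaneous substitution `bind` and
  `subst z H = F(z/H)`.
* `PICircuit 𝔽 X`: circuits in STRAIGHT-LINE (topologically sorted) presentation: a list `body`
  of nodes followed by the output node `out`; a node is `var x`, `const c`, `add i j` or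
  `mul i j` with `i, j` the absolute positions of its left/right children. `size` = number of
  nodes = `body.length + 1`; `F + G` / `F · G` (`PICircuit.add/mul`) put disjoint copies of `F`
  and `G` side by side under a new output node; `F_u` is `prefixAt F u`, the initial segment
  ending at node `u` (it contains every node `F_u` can reach; nodes of the segment not reachable
  from `u` are dead weight that only increases size); `unfold` is HT's unfolding `F•` into a
  formula (Remark 1.3) and `eval F := F.unfold.eval = F̂`. A child index that does not point to
  an EARLIER node is junk and unfolds to the leaf `0` (the same junk convention as the tree's
  `ArithCircuit`; it never helps a proof by more than the constant factor 3 in size).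
  Every DAG in HT's sense has such a presentation of the same size, unfolding and depth, and two
  presentations of one DAG are similar (same unfolding), hence inter-derivable by A1, C1, C2 in
  polynomial size (Remark 1.3): the Lean systems prove the same equations as HT's, `P_f` with
  identical measures, `P_c` with sizes preserved up to the polynomial slack of Remark 1.3 and
  with the counts of A2–A10 instances preserved exactly.
* `PISystem 𝔽 T`: the data both systems share — the disjoint sum/product on the term language
  `T`, the constant leaves, the EXTRA axiom schemes (`none` for `P_f`, C1/C2 for `P_c`) and the
  size measure; `PISystem.RingAxiom` are the schemes A1–A10 as printed, `PISystem.IsAxiom` adds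
  the extra schemes. `PIProof S Γ` is a proof in system `S` whose lines, last line first, are
  the list `Γ` of equations: an inductive type whose constructors are "empty proof", "append an
  axiom instance" and the four rules R1–R4 applied to EARLIER lines (membership in `Γ`).
  Measures: `lineCount`, `size` (sum over all lines of the sizes of both sides), `axiomCount s`
  (number of lines introduced as instances of scheme `s`), `maxDepth`.
* `pfSystem 𝔽 X`, `pcSystem 𝔽 X`, `PFProof`, `PCProof`: the two systems. Existence predicates:
  `PISystem.Provable S F G size budget` (a proof of `F = G` of size `≤ size : ℕ∞` using at most
  `budget s : ℕ∞` instances of each scheme `s`), `HasPFProofOfSize`, `HasPCProofOfSize`,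
  `HasPCProof` (axiom-metered), `HasPCProofWithin` (both).
* Proved API: soundness (HT Prop. 1.1 "⇒", by induction on the proof: `PIProof.sound`,
  `PFProof.eval_eq`, `PCProof.eval_eq`, `HasPFProofOfSize.eval_eq`, `HasPCProofOfSize.eval_eq`);
  monotonicity in the budgets; concatenation of proofs (`PIProof.append`) and the derived
  calculus on `Provable` (`of_isAxiom`, `refl`, `symm`, `trans`, `add`, `mul`, with exact size
  and axiom-count bookkeeping); functoriality along system morphisms (`PISystem.Hom`,
  `PIProof.map`, preserving line and axiom counts, size up to the morphism's factor), whence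
  closure under variable renaming (both systems, size preserved), under substitution `F(z/H)`
  for `P_f` (size `≤ |H| ·` size; HT §1.1 "proofs are closed under substitution") and the
  embedding `P_f ⊆ P_c` (`PIFormula.toCircuit`); the unfolding/evaluation/size lemmas for
  `PICircuit.add/mul/prefixAt/rename`.
* NOT here (follow-ups): completeness (Prop. 1.1 "⇐", normal forms), Prop. 1.2, the polynomial
  derivability of A1' (Remark 1.3), closure of `P_c` proofs under circuit substitution, division
  gates (`P_I`, §7), and the systems IPS / PC / Nullstellensatz (different objects; cf.
  `Literature.Computability.Complexity.NullstellensatzPC`). Constants: HT take a field `𝔽`; all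
  definitions here only use a commutative semiring of constants.
* The tree's `ArithExpr` (`PermanentCompleteness.lean`, BCS (21.19), size = number of
  operations) has the same shape as `PIFormula`; it is not reused so that this file imports
  nothing but `MvPolynomial` (the proof systems are foundational for proof-complexity routes and
  must not carry the permanent-completeness cone); `PIFormula.size = 2·E + 1` in BCS's measure.
-/

noncomputable section

open MvPolynomial

namespace Literature.Computability.AlgebraicComplexity

universe u v w

/-! ### Axiom schemes -/

/-- The axiom schemes of Hrubeš–Tzameret's systems: A1 `F = F`, A2 `F+G = G+F`,
A3 `F+(G+H) = (F+G)+H`, A4 `FG = GF`, A5 `F(GH) = (FG)H`, A6 `F(G+H) = FG+FH`, A7 `F+0 = F`,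
A8 `F·0 = 0`, A9 `F·1 = F`, A10 true constant equations `a = b+c`, `a' = b'c'`; and for circuits
C1 `F₁ ⊕ F₂ = F₁ + F₂`, C2 `F₁ ⊗ F₂ = F₁·F₂`. [cite: HrubesTzameret2015, §1.1] -/
inductive PIAxiom : Type
  | A1 | A2 | A3 | A4 | A5 | A6 | A7 | A8 | A9 | A10 | C1 | C2
  deriving DecidableEq, Fintype, Repr

/-! ### Arithmetic formulas -/

/-- Arithmetic formulas over constants `𝔽` and variables `X`: trees whose leaves are labelled by
a variable or an element of `𝔽` and whose internal nodes are binary `+` / `×` gates with ordered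
(left/right) arguments (Hrubeš–Tzameret §1.1). [cite: HrubesTzameret2015, §1.1] -/
inductive PIFormula (𝔽 : Type u) (X : Type v) : Type (max u v)
  /-- the leaf labelled by the variable `x` -/
  | var (x : X) : PIFormula 𝔽 X
  /-- the leaf labelled by the field element `c` -/
  | const (c : 𝔽) : PIFormula 𝔽 X
  /-- the gate `F + G` -/
  | add (F G : PIFormula 𝔽 X) : PIFormula 𝔽 X
  /-- the gate `F × G` -/
  | mul (F G : PIFormula 𝔽 X) : PIFormula 𝔽 X
  deriving DecidableEq

namespace PIFormula

variable {𝔽 : Type u} {X : Type v} {Y : Type w}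

/-- The size of a formula: its number of nodes (leaves and gates) (HT §1.1 "the size of a
circuit is the number of nodes in it"). [cite: HrubesTzameret2015, §1.1] -/
def size : PIFormula 𝔽 X → ℕ
  | var _ => 1
  | const _ => 1
  | add F G => F.size + G.size + 1
  | mul F G => F.size + G.size + 1

/-- Unfolding of `size`. [cite: HrubesTzameret2015, §1.1] -/
@[simp] theorem size_var (x : X) : (var x : PIFormula 𝔽 X).size = 1 := rfl
/-- Unfolding of `size`. [cite: HrubesTzameret2015, §1.1] -/
@[simp] theorem size_const (c : 𝔽) : (const c : PIFormula 𝔽 X).size = 1 := rfl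
/-- Unfolding of `size`. [cite: HrubesTzameret2015, §1.1] -/
@[simp] theorem size_add (F G : PIFormula 𝔽 X) : (add F G).size = F.size + G.size + 1 := rfl
/-- Unfolding of `size`. [cite: HrubesTzameret2015, §1.1] -/
@[simp] theorem size_mul (F G : PIFormula 𝔽 X) : (mul F G).size = F.size + G.size + 1 := rfl

/-- Every formula has at least one node. [cite: HrubesTzameret2015, §1.1] -/
theorem one_le_size (F : PIFormula 𝔽 X) : 1 ≤ F.size := by
  cases F <;> simp

/-- The depth of a formula: the length of a longest leaf-to-root path (HT §1.1).
[cite: HrubesTzameret2015, §1.1] -/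
def depth : PIFormula 𝔽 X → ℕ
  | var _ => 0
  | const _ => 0
  | add F G => max F.depth G.depth + 1
  | mul F G => max F.depth G.depth + 1

/-- Renaming the variables of a formula along `f : X → Y` (a relabelling of the leaves; HT's
proofs are manipulated up to such relabellings, cf. §1.1 "substitution"). [cite: HrubesTzameret2015, §1.1] -/
def rename (f : X → Y) : PIFormula 𝔽 X → PIFormula 𝔽 Y
  | var x => var (f x)
  | const c => const c
  | add F G => add (F.rename f) (G.rename f)
  | mul F G => mul (F.rename f) (G.rename f)

/-- Renaming does not change the size. [cite: HrubesTzameret2015, §1.1] -/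
@[simp] theorem size_rename (f : X → Y) (F : PIFormula 𝔽 X) : (F.rename f).size = F.size := by
  induction F <;> simp [rename, *]

/-- Renaming does not change the depth. [cite: HrubesTzameret2015, §1.1] -/
@[simp] theorem depth_rename (f : X → Y) (F : PIFormula 𝔽 X) : (F.rename f).depth = F.depth := by
  induction F <;> simp [rename, depth, *]

/-- Simultaneous substitution: every leaf `var x` is replaced by (a fresh copy of) the formula
`τ x` (HT §1.1, substitution `F(z/H)` is the case `τ = Function.update var z H`).
[cite: HrubesTzameret2015, §1.1] -/
def bind (τ : X → PIFormula 𝔽 Y) : PIFormula 𝔽 X → PIFormula 𝔽 Y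
  | var x => τ x
  | const c => const c
  | add F G => add (F.bind τ) (G.bind τ)
  | mul F G => mul (F.bind τ) (G.bind τ)

/-- Size of a substitution instance: if every substituted formula has size `≤ m` (`1 ≤ m`),
then `|F.bind τ| ≤ m · |F|`. [cite: HrubesTzameret2015, §1.1] -/
theorem size_bind_le (τ : X → PIFormula 𝔽 Y) (m : ℕ) (hm : 1 ≤ m) (hτ : ∀ x, (τ x).size ≤ m)
    (F : PIFormula 𝔽 X) : (F.bind τ).size ≤ m * F.size := by
  induction F with
  | var x => simpa [bind] using hτ x
  | const c => simpa [bind] using hm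
  | add F G ihF ihG => simp only [bind, size_add, Nat.mul_add, Nat.mul_one]; omega
  | mul F G ihF ihG => simp only [bind, size_mul, Nat.mul_add, Nat.mul_one]; omega

/-- The substitution `F(z/H)`: every leaf labelled `z` is replaced by a copy of `H`
(HT §1.1). [cite: HrubesTzameret2015, §1.1] -/
def subst [DecidableEq X] (F : PIFormula 𝔽 X) (z : X) (H : PIFormula 𝔽 X) : PIFormula 𝔽 X :=
  F.bind (Function.update var z H)

/-- `|F(z/H)| ≤ |H| · |F|`. [cite: HrubesTzameret2015, §1.1] -/
theorem size_subst_le [DecidableEq X] (F : PIFormula 𝔽 X) (z : X) (H : PIFormula 𝔽 X) :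
    (F.subst z H).size ≤ H.size * F.size := by
  refine size_bind_le _ _ H.one_le_size (fun x => ?_) F
  rcases eq_or_ne x z with rfl | hx
  · simp
  · simp [Function.update_of_ne hx, H.one_le_size]

section Semantics

variable [CommSemiring 𝔽]

/-- The polynomial `F̂ ∈ 𝔽[X]` computed by a formula (HT §1.1: a leaf computes its label,
`F ⊕ G` computes `F̂ + Ĝ`, `F ⊗ G` computes `F̂ · Ĝ`). [cite: HrubesTzameret2015, §1.1] -/
def eval : PIFormula 𝔽 X → MvPolynomial X 𝔽
  | var x => MvPolynomial.X x
  | const c => C c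
  | add F G => F.eval + G.eval
  | mul F G => F.eval * G.eval

/-- Unfolding of `eval`. [cite: HrubesTzameret2015, §1.1] -/
@[simp] theorem eval_var (x : X) : (var x : PIFormula 𝔽 X).eval = MvPolynomial.X x := rfl
/-- Unfolding of `eval`. [cite: HrubesTzameret2015, §1.1] -/
@[simp] theorem eval_const (c : 𝔽) : (const c : PIFormula 𝔽 X).eval = C c := rfl
/-- Unfolding of `eval`. [cite: HrubesTzameret2015, §1.1] -/
@[simp] theorem eval_add (F G : PIFormula 𝔽 X) : (add F G).eval = F.eval + G.eval := rfl
/-- Unfolding of `eval`. [cite: HrubesTzameret2015, §1.1] -/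
@[simp] theorem eval_mul (F G : PIFormula 𝔽 X) : (mul F G).eval = F.eval * G.eval := rfl

/-- Renaming the leaves renames the computed polynomial. [cite: HrubesTzameret2015, §1.1] -/
@[simp] theorem eval_rename (f : X → Y) (F : PIFormula 𝔽 X) :
    (F.rename f).eval = MvPolynomial.rename f F.eval := by
  induction F <;> simp [rename, *]

/-- Substitution on formulas is substitution (`MvPolynomial.bind₁`) on polynomials.
[cite: HrubesTzameret2015, §1.1] -/
@[simp] theorem eval_bind (τ : X → PIFormula 𝔽 Y) (F : PIFormula 𝔽 X) :
    (F.bind τ).eval = MvPolynomial.bind₁ (fun x => (τ x).eval) F.eval := by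
  induction F <;> simp [bind, *]

end Semantics

end PIFormula

/-! ### Arithmetic circuits in straight-line presentation -/

namespace PICircuit

/-- A node of a circuit in straight-line presentation: a leaf labelled by a variable or a
constant, or a binary `+` / `×` gate whose left and right children are the nodes at (absolute)
positions `i` and `j` of the presentation (HT §1.1: in-degree-two nodes with in-edges labelled
left/right). [cite: HrubesTzameret2015, §1.1] -/
inductive Node (𝔽 : Type u) (X : Type v) : Type (max u v)
  /-- leaf labelled by the variable `x` -/
  | var (x : X) : Node 𝔽 X
  /-- leaf labelled by the constant `c` -/
  | const (c : 𝔽) : Node 𝔽 X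
  /-- gate `(node i) + (node j)` -/
  | add (i j : ℕ) : Node 𝔽 X
  /-- gate `(node i) × (node j)` -/
  | mul (i j : ℕ) : Node 𝔽 X
  deriving DecidableEq

end PICircuit

/-- Arithmetic circuits (HT §1.1: DAGs with variable/constant leaves, binary `+`/`×` gates and one
output node) in straight-line (topologically sorted) presentation: the list `body` of all
non-output nodes followed by the output node `out`; gate children are referenced by absolute
position and are meant to be EARLIER nodes (a reference that is not is junk and unfolds to the
leaf `0`, see `PICircuit.Node.unfold`). [cite: HrubesTzameret2015, §1.1] -/
structure PICircuit (𝔽 : Type u) (X : Type v) : Type (max u v) where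
  /-- the non-output nodes, in topological order -/
  body : List (PICircuit.Node 𝔽 X)
  /-- the output node -/
  out : PICircuit.Node 𝔽 X
  deriving DecidableEq

namespace PICircuit

variable {𝔽 : Type u} {X : Type v} {Y : Type w}

namespace Node

/-- Shift the child references of a node by `k` (used to place a copy of a circuit after `k`
other nodes). [cite: HrubesTzameret2015, §1.1] -/
def shift (k : ℕ) : Node 𝔽 X → Node 𝔽 X
  | var x => var x
  | const c => const c
  | add i j => add (i + k) (j + k)
  | mul i j => mul (i + k) (j + k)

/-- Rename the variable label of a leaf along `f : X → Y`. [cite: HrubesTzameret2015, §1.1] -/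
def rename (f : X → Y) : Node 𝔽 X → Node 𝔽 Y
  | var x => var (f x)
  | const c => const c
  | add i j => add i j
  | mul i j => mul i j

/-- Unfolding of `shift`. [cite: HrubesTzameret2015, §1.1] -/
@[simp] theorem shift_var (k : ℕ) (x : X) : (var x : Node 𝔽 X).shift k = var x := rfl
/-- Unfolding of `shift`. [cite: HrubesTzameret2015, §1.1] -/
@[simp] theorem shift_const (k : ℕ) (c : 𝔽) : (const c : Node 𝔽 X).shift k = const c := rfl
/-- Unfolding of `shift`. [cite: HrubesTzameret2015, §1.1] -/
@[simp] theorem shift_add (k i j : ℕ) : (add i j : Node 𝔽 X).shift k = add (i + k) (j + k) := rfl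
/-- Unfolding of `shift`. [cite: HrubesTzameret2015, §1.1] -/
@[simp] theorem shift_mul (k i j : ℕ) : (mul i j : Node 𝔽 X).shift k = mul (i + k) (j + k) := rfl
/-- Unfolding of `rename`. [cite: HrubesTzameret2015, §1.1] -/
@[simp] theorem rename_var (f : X → Y) (x : X) : (var x : Node 𝔽 X).rename f = var (f x) := rfl
/-- Unfolding of `rename`. [cite: HrubesTzameret2015, §1.1] -/
@[simp] theorem rename_const (f : X → Y) (c : 𝔽) : (const c : Node 𝔽 X).rename f = const c := rfl
/-- Unfolding of `rename`. [cite: HrubesTzameret2015, §1.1] -/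
@[simp] theorem rename_add (f : X → Y) (i j : ℕ) : (add i j : Node 𝔽 X).rename f = add i j := rfl
/-- Unfolding of `rename`. [cite: HrubesTzameret2015, §1.1] -/
@[simp] theorem rename_mul (f : X → Y) (i j : ℕ) : (mul i j : Node 𝔽 X).rename f = mul i j := rfl

/-- Renaming commutes with shifting. [cite: HrubesTzameret2015, §1.1] -/
theorem rename_shift (f : X → Y) (k : ℕ) (n : Node 𝔽 X) :
    (n.shift k).rename f = (n.rename f).shift k := by
  cases n <;> rfl

/-- The depth of a node given the depths `ds` of the earlier nodes (leaves have depth `0`).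
[cite: HrubesTzameret2015, §1.1] -/
def depthOf (ds : List ℕ) : Node 𝔽 X → ℕ
  | var _ => 0
  | const _ => 0
  | add i j => max (ds.getD i 0) (ds.getD j 0) + 1
  | mul i j => max (ds.getD i 0) (ds.getD j 0) + 1

variable [Zero 𝔽]

/-- The unfolding of a node into a formula, given the unfoldings `vals` of the earlier nodes
(HT Remark 1.3: `(G ⊕ H)• = G• + H•`); a junk reference unfolds to the leaf `0`.
[cite: HrubesTzameret2015, Remark 1.3] -/
def unfold (vals : List (PIFormula 𝔽 X)) : Node 𝔽 X → PIFormula 𝔽 X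
  | var x => .var x
  | const c => .const c
  | add i j => .add (vals.getD i (.const 0)) (vals.getD j (.const 0))
  | mul i j => .mul (vals.getD i (.const 0)) (vals.getD j (.const 0))

/-- A shifted node placed after `pre.length` nodes unfolds as the original node.
[cite: HrubesTzameret2015, Remark 1.3] -/
theorem unfold_shift (pre ws : List (PIFormula 𝔽 X)) (n : Node 𝔽 X) :
    (n.shift pre.length).unfold (pre ++ ws) = n.unfold ws := by
  have h (i : ℕ) : (pre ++ ws).getD (i + pre.length) (.const 0 : PIFormula 𝔽 X) =
      ws.getD i (.const 0) := by
    rw [List.getD_append_right _ _ _ _ (Nat.le_add_left _ _), Nat.add_sub_cancel]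
  cases n <;> simp only [shift, unfold, h]

/-- Unfolding commutes with renaming. [cite: HrubesTzameret2015, Remark 1.3] -/
theorem unfold_rename (f : X → Y) (vals : List (PIFormula 𝔽 X)) (n : Node 𝔽 X) :
    (n.rename f).unfold (vals.map (PIFormula.rename f)) = (n.unfold vals).rename f := by
  have h (i : ℕ) : (vals.map (PIFormula.rename f)).getD i (.const 0) =
      (vals.getD i (.const 0)).rename f :=
    List.getD_map vals (PIFormula.const 0) (PIFormula.rename f)
  cases n <;> simp only [rename, unfold, PIFormula.rename, h]

end Node

/-- The size of a circuit: its number of nodes (HT §1.1). [cite: HrubesTzameret2015, §1.1] -/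
def size (C : PICircuit 𝔽 X) : ℕ := C.body.length + 1

/-- All nodes of a circuit in order, the output node last. [cite: HrubesTzameret2015, §1.1] -/
def nodes (C : PICircuit 𝔽 X) : List (Node 𝔽 X) := C.body ++ [C.out]

/-- A circuit has `size` nodes. [cite: HrubesTzameret2015, §1.1] -/
@[simp] theorem length_nodes (C : PICircuit 𝔽 X) : C.nodes.length = C.size := by
  simp [nodes, size]

/-- Every circuit has at least one node. [cite: HrubesTzameret2015, §1.1] -/
theorem one_le_size (C : PICircuit 𝔽 X) : 1 ≤ C.size := Nat.le_add_left 1 _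

/-- The one-node circuit labelled by the variable `x`. [cite: HrubesTzameret2015, §1.1] -/
def var (x : X) : PICircuit 𝔽 X := ⟨[], .var x⟩

/-- The one-node circuit labelled by the constant `c`. [cite: HrubesTzameret2015, §1.1] -/
def const (c : 𝔽) : PICircuit 𝔽 X := ⟨[], .const c⟩

/-- `F + G`: disjoint copies of `F` and `G` side by side and a new output node adding their
output nodes (HT §1.1: "`F + G` denotes the unique circuit `F' ⊕ G'` where `F', G'` are disjoint
copies of `F` and `G`"). [cite: HrubesTzameret2015, §1.1] -/
def add (F G : PICircuit 𝔽 X) : PICircuit 𝔽 X :=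
  ⟨F.nodes ++ G.nodes.map (Node.shift F.size), .add F.body.length (F.size + G.body.length)⟩

/-- `F · G`: disjoint copies of `F` and `G` side by side and a new output node multiplying their
output nodes (HT §1.1). [cite: HrubesTzameret2015, §1.1] -/
def mul (F G : PICircuit 𝔽 X) : PICircuit 𝔽 X :=
  ⟨F.nodes ++ G.nodes.map (Node.shift F.size), .mul F.body.length (F.size + G.body.length)⟩

/-- `|x| = 1`. [cite: HrubesTzameret2015, §1.1] -/
@[simp] theorem size_var (x : X) : (var x : PICircuit 𝔽 X).size = 1 := rfl
/-- `|c| = 1`. [cite: HrubesTzameret2015, §1.1] -/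
@[simp] theorem size_const (c : 𝔽) : (const c : PICircuit 𝔽 X).size = 1 := rfl
/-- `|F + G| = |F| + |G| + 1`. [cite: HrubesTzameret2015, §1.1] -/
@[simp] theorem size_add (F G : PICircuit 𝔽 X) : (add F G).size = F.size + G.size + 1 := by
  simp only [size, add, List.length_append, length_nodes, List.length_map]
/-- `|F · G| = |F| + |G| + 1`. [cite: HrubesTzameret2015, §1.1] -/
@[simp] theorem size_mul (F G : PICircuit 𝔽 X) : (mul F G).size = F.size + G.size + 1 := by
  simp only [size, mul, List.length_append, length_nodes, List.length_map]

/-- Renaming the variable leaves of a circuit along `f : X → Y` (the route's relabelling of the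
inputs `x_ij ↦ x_{τ i, τ j}`). [cite: HrubesTzameret2015, §1.1] -/
def rename (f : X → Y) (C : PICircuit 𝔽 X) : PICircuit 𝔽 Y :=
  ⟨C.body.map (Node.rename f), C.out.rename f⟩

/-- Renaming preserves the size. [cite: HrubesTzameret2015, §1.1] -/
@[simp] theorem size_rename (f : X → Y) (C : PICircuit 𝔽 X) : (C.rename f).size = C.size := by
  simp [rename, size]

/-- The nodes of a renamed circuit. [cite: HrubesTzameret2015, §1.1] -/
theorem nodes_rename (f : X → Y) (C : PICircuit 𝔽 X) :
    (C.rename f).nodes = C.nodes.map (Node.rename f) := by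
  simp [rename, nodes]

/-- Renaming commutes with `F + G`. [cite: HrubesTzameret2015, §1.1] -/
theorem rename_add (f : X → Y) (F G : PICircuit 𝔽 X) :
    (add F G).rename f = add (F.rename f) (G.rename f) := by
  have hcomp : (Node.rename f ∘ Node.shift (F.body.length + 1) : Node 𝔽 X → Node 𝔽 Y) =
      Node.shift (F.body.length + 1) ∘ Node.rename f :=
    funext (Node.rename_shift f (F.body.length + 1))
  simp only [add, rename, nodes, size, List.map_append, List.map_map, List.map_cons, List.map_nil,
    List.length_map, hcomp, Node.rename_shift, Node.rename_add]

/-- Renaming commutes with `F · G`. [cite: HrubesTzameret2015, §1.1] -/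
theorem rename_mul (f : X → Y) (F G : PICircuit 𝔽 X) :
    (mul F G).rename f = mul (F.rename f) (G.rename f) := by
  have hcomp : (Node.rename f ∘ Node.shift (F.body.length + 1) : Node 𝔽 X → Node 𝔽 Y) =
      Node.shift (F.body.length + 1) ∘ Node.rename f :=
    funext (Node.rename_shift f (F.body.length + 1))
  simp only [mul, rename, nodes, size, List.map_append, List.map_map, List.map_cons, List.map_nil,
    List.length_map, hcomp, Node.rename_shift, Node.rename_mul]

/-- The depths of the nodes of `body` (after earlier nodes of depths `init`).
[cite: HrubesTzameret2015, §1.1] -/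
def depthList (init : List ℕ) (body : List (Node 𝔽 X)) : List ℕ :=
  body.foldl (fun ds n => ds ++ [n.depthOf ds]) init

/-- The depth of a circuit: the length of a longest directed path ending in the output node
(HT §1.1; nodes not reaching the output do not count). [cite: HrubesTzameret2015, §1.1] -/
def depth (C : PICircuit 𝔽 X) : ℕ := C.out.depthOf (depthList [] C.body)

section Unfold

variable [Zero 𝔽]

/-- The subcircuit `F_u` with output node `u` (HT §1.1), in straight-line presentation: the
initial segment of `F` ending at node `u` (junk `u` gives the segment followed by the leaf `0`).
[cite: HrubesTzameret2015, §1.1] -/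
def prefixAt (C : PICircuit 𝔽 X) (u : ℕ) : PICircuit 𝔽 X :=
  ⟨C.body.take u, C.body.getD u (.const 0)⟩

/-- `|F_u| ≤ |F|`. [cite: HrubesTzameret2015, §1.1] -/
theorem size_prefixAt_le (C : PICircuit 𝔽 X) (u : ℕ) : (C.prefixAt u).size ≤ C.size := by
  simp only [prefixAt, size, List.length_take]
  omega

/-- `F_u` commutes with renaming. [cite: HrubesTzameret2015, §1.1] -/
theorem prefixAt_rename (f : X → Y) (C : PICircuit 𝔽 X) (u : ℕ) :
    (C.rename f).prefixAt u = (C.prefixAt u).rename f := by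
  simp only [prefixAt, rename, List.map_take, PICircuit.mk.injEq, true_and]
  exact List.getD_map C.body (Node.const 0) (Node.rename f)

/-- The unfoldings of the nodes `body` placed after earlier nodes with unfoldings `init`: the
list `init` followed by the unfolding of each node of `body` (HT Remark 1.3).
[cite: HrubesTzameret2015, Remark 1.3] -/
def unfoldList (init : List (PIFormula 𝔽 X)) (body : List (Node 𝔽 X)) : List (PIFormula 𝔽 X) :=
  body.foldl (fun vals n => vals ++ [n.unfold vals]) init

/-- The unfolding `F•` of a circuit into a formula (HT Remark 1.3: `F• = F` for a leaf,
`(G ⊕ H)• = G• + H•`, `(G ⊗ H)• = G• · H•`). [cite: HrubesTzameret2015, Remark 1.3] -/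
def unfold (C : PICircuit 𝔽 X) : PIFormula 𝔽 X := C.out.unfold (unfoldList [] C.body)

/-- `unfoldList` on an empty body. [cite: HrubesTzameret2015, Remark 1.3] -/
@[simp] theorem unfoldList_nil (init : List (PIFormula 𝔽 X)) : unfoldList init ([] : List (Node 𝔽 X)) = init := rfl

/-- `unfoldList` on a first node. [cite: HrubesTzameret2015, Remark 1.3] -/
theorem unfoldList_cons (init : List (PIFormula 𝔽 X)) (n : Node 𝔽 X) (body : List (Node 𝔽 X)) :
    unfoldList init (n :: body) = unfoldList (init ++ [n.unfold init]) body := rfl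

/-- `unfoldList` on a concatenation. [cite: HrubesTzameret2015, Remark 1.3] -/
theorem unfoldList_append (init : List (PIFormula 𝔽 X)) (l₁ l₂ : List (Node 𝔽 X)) :
    unfoldList init (l₁ ++ l₂) = unfoldList (unfoldList init l₁) l₂ := List.foldl_append

/-- `unfoldList` produces one unfolding per node. [cite: HrubesTzameret2015, Remark 1.3] -/
@[simp] theorem length_unfoldList (init : List (PIFormula 𝔽 X)) (body : List (Node 𝔽 X)) :
    (unfoldList init body).length = init.length + body.length := by
  induction body generalizing init with
  | nil => simp
  | cons n body ih => simp only [unfoldList_cons, ih, List.length_append, List.length_cons,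
      List.length_nil]; omega

/-- `unfoldList init body` starts with `init`. [cite: HrubesTzameret2015, Remark 1.3] -/
theorem unfoldList_eq_append (init : List (PIFormula 𝔽 X)) (body : List (Node 𝔽 X)) :
    ∃ t, unfoldList init body = init ++ t := by
  induction body generalizing init with
  | nil => exact ⟨[], by simp⟩
  | cons n body ih =>
    obtain ⟨t, ht⟩ := ih (init ++ [n.unfold init])
    exact ⟨n.unfold init :: t, by rw [unfoldList_cons, ht, List.append_assoc, List.singleton_append]⟩

/-- Earlier unfoldings are unchanged by later nodes. [cite: HrubesTzameret2015, Remark 1.3] -/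
theorem getD_unfoldList_of_lt (init : List (PIFormula 𝔽 X)) (body : List (Node 𝔽 X)) {i : ℕ}
    (hi : i < init.length) (d : PIFormula 𝔽 X) : (unfoldList init body).getD i d = init.getD i d := by
  obtain ⟨t, ht⟩ := unfoldList_eq_append init body
  rw [ht, List.getD_append _ _ _ _ hi]

/-- A copy of a circuit placed after `pre.length` nodes (references shifted) unfolds, node by
node, as the original. [cite: HrubesTzameret2015, Remark 1.3] -/
theorem unfoldList_map_shift (pre ws : List (PIFormula 𝔽 X)) (l : List (Node 𝔽 X)) :
    unfoldList (pre ++ ws) (l.map (Node.shift pre.length)) = pre ++ unfoldList ws l := by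
  induction l generalizing ws with
  | nil => simp
  | cons n l ih =>
    rw [List.map_cons, unfoldList_cons, unfoldList_cons, Node.unfold_shift, List.append_assoc, ih]

/-- The unfoldings of all nodes of `C`: those of the body, then `C•`.
[cite: HrubesTzameret2015, Remark 1.3] -/
theorem unfoldList_nodes (init : List (PIFormula 𝔽 X)) (C : PICircuit 𝔽 X) :
    unfoldList init C.nodes = unfoldList init C.body ++ [C.out.unfold (unfoldList init C.body)] := by
  rw [nodes, unfoldList_append, unfoldList_cons, unfoldList_nil]

/-- The last unfolding of the nodes of `C` (after no earlier node) is `C•`.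
[cite: HrubesTzameret2015, Remark 1.3] -/
theorem getD_unfoldList_nodes (C : PICircuit 𝔽 X) (d : PIFormula 𝔽 X) :
    (unfoldList [] C.nodes).getD C.body.length d = C.unfold := by
  rw [unfoldList_nodes, List.getD_append_right _ _ _ _ (by simp)]
  simp [unfold]

/-- `(F + G)• = F• + G•` (HT Remark 1.3). [cite: HrubesTzameret2015, Remark 1.3] -/
@[simp] theorem unfold_add (F G : PICircuit 𝔽 X) : (add F G).unfold = .add F.unfold G.unfold := by
  have hF : (unfoldList [] F.nodes).length = F.size := by simp
  have key : unfoldList [] (F.nodes ++ G.nodes.map (Node.shift F.size)) =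
      unfoldList [] F.nodes ++ unfoldList [] G.nodes := by
    rw [unfoldList_append, ← hF]
    simpa using unfoldList_map_shift (unfoldList [] F.nodes) [] G.nodes
  simp only [unfold, add, Node.unfold, key]
  rw [List.getD_append _ _ _ _ (by simp [size]), List.getD_append_right _ _ _ _ (by simp),
    hF, Nat.add_sub_cancel_left, getD_unfoldList_nodes, getD_unfoldList_nodes]
  rfl

/-- `(F · G)• = F• · G•` (HT Remark 1.3). [cite: HrubesTzameret2015, Remark 1.3] -/
@[simp] theorem unfold_mul (F G : PICircuit 𝔽 X) : (mul F G).unfold = .mul F.unfold G.unfold := by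
  have hF : (unfoldList [] F.nodes).length = F.size := by simp
  have key : unfoldList [] (F.nodes ++ G.nodes.map (Node.shift F.size)) =
      unfoldList [] F.nodes ++ unfoldList [] G.nodes := by
    rw [unfoldList_append, ← hF]
    simpa using unfoldList_map_shift (unfoldList [] F.nodes) [] G.nodes
  simp only [unfold, mul, Node.unfold, key]
  rw [List.getD_append _ _ _ _ (by simp [size]), List.getD_append_right _ _ _ _ (by simp),
    hF, Nat.add_sub_cancel_left, getD_unfoldList_nodes, getD_unfoldList_nodes]
  rfl

/-- `x• = x`. [cite: HrubesTzameret2015, Remark 1.3] -/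
@[simp] theorem unfold_var (x : X) : (var x : PICircuit 𝔽 X).unfold = .var x := rfl
/-- `c• = c`. [cite: HrubesTzameret2015, Remark 1.3] -/
@[simp] theorem unfold_const (c : 𝔽) : (const c : PICircuit 𝔽 X).unfold = .const c := rfl

/-- The unfolding of node `u` of a body is the unfolding of the initial segment ending at `u`.
[cite: HrubesTzameret2015, Remark 1.3] -/
theorem getD_unfoldList_eq_unfold_prefixAt (body : List (Node 𝔽 X)) (out : Node 𝔽 X) (u : ℕ) :
    (unfoldList [] body).getD u (.const 0) = ((⟨body, out⟩ : PICircuit 𝔽 X).prefixAt u).unfold := by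
  simp only [prefixAt, unfold]
  rcases lt_or_ge u body.length with hu | hu
  · conv_lhs => rw [← List.take_append_drop u body, List.drop_eq_getElem_cons hu, unfoldList_append,
      unfoldList_cons]
    rw [getD_unfoldList_of_lt _ _ (by simp [hu.le]), List.getD_append_right _ _ _ _ (by simp [hu.le]),
      List.getD_eq_getElem _ _ hu]
    simp [hu.le]
  · rw [List.getD_eq_default _ _ (by simpa using hu), List.getD_eq_default _ _ hu]
    rfl

/-- A circuit whose output node is a `+` gate unfolds as the sum of its two subcircuits:
`(F_u ⊕ F_v)• = (F_u + F_v)•` (HT §1.1, Remark 1.3). [cite: HrubesTzameret2015, Remark 1.3] -/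
theorem unfold_eq_of_out_add (body : List (Node 𝔽 X)) (u v : ℕ) :
    (⟨body, .add u v⟩ : PICircuit 𝔽 X).unfold =
      (add ((⟨body, .add u v⟩ : PICircuit 𝔽 X).prefixAt u)
        ((⟨body, .add u v⟩ : PICircuit 𝔽 X).prefixAt v)).unfold := by
  rw [unfold_add, ← getD_unfoldList_eq_unfold_prefixAt, ← getD_unfoldList_eq_unfold_prefixAt]
  rfl

/-- A circuit whose output node is a `×` gate unfolds as the product of its two subcircuits:
`(F_u ⊗ F_v)• = (F_u · F_v)•` (HT §1.1, Remark 1.3). [cite: HrubesTzameret2015, Remark 1.3] -/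
theorem unfold_eq_of_out_mul (body : List (Node 𝔽 X)) (u v : ℕ) :
    (⟨body, .mul u v⟩ : PICircuit 𝔽 X).unfold =
      (mul ((⟨body, .mul u v⟩ : PICircuit 𝔽 X).prefixAt u)
        ((⟨body, .mul u v⟩ : PICircuit 𝔽 X).prefixAt v)).unfold := by
  rw [unfold_mul, ← getD_unfoldList_eq_unfold_prefixAt, ← getD_unfoldList_eq_unfold_prefixAt]
  rfl

/-- Unfolding commutes with renaming, node by node. [cite: HrubesTzameret2015, Remark 1.3] -/
theorem unfoldList_map_rename (f : X → Y) (init : List (PIFormula 𝔽 X)) (body : List (Node 𝔽 X)) :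
    unfoldList (init.map (PIFormula.rename f)) (body.map (Node.rename f)) =
      (unfoldList init body).map (PIFormula.rename f) := by
  induction body generalizing init with
  | nil => simp
  | cons n body ih =>
    rw [List.map_cons, unfoldList_cons, unfoldList_cons, Node.unfold_rename, ← ih]
    simp

/-- `(F.rename f)• = F•.rename f`. [cite: HrubesTzameret2015, Remark 1.3] -/
@[simp] theorem unfold_rename (f : X → Y) (C : PICircuit 𝔽 X) :
    (C.rename f).unfold = C.unfold.rename f := by
  simpa [unfold, rename] using
    (Node.unfold_rename f (unfoldList [] C.body) C.out ▸
      congrArg (fun vs => (C.out.rename f).unfold vs) (unfoldList_map_rename f [] C.body))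

/-- The extra axiom schemes of `P_c`: C1 `F₁ ⊕ F₂ = F₁ + F₂` and C2 `F₁ ⊗ F₂ = F₁ · F₂` — a
circuit whose output node is `u + v` (`u × v`) equals the disjoint sum (product) of its
subcircuits `F_u`, `F_v` (HT §1.1). [cite: HrubesTzameret2015, §1.1] -/
inductive IsExtra : PIAxiom → PICircuit 𝔽 X → PICircuit 𝔽 X → Prop
  /-- C1: `F_u ⊕ F_v = F_u + F_v` -/
  | c1 (body : List (Node 𝔽 X)) (u v : ℕ) :
      IsExtra .C1 ⟨body, .add u v⟩
        (add ((⟨body, .add u v⟩ : PICircuit 𝔽 X).prefixAt u) ((⟨body, .add u v⟩ : PICircuit 𝔽 X).prefixAt v))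
  /-- C2: `F_u ⊗ F_v = F_u · F_v` -/
  | c2 (body : List (Node 𝔽 X)) (u v : ℕ) :
      IsExtra .C2 ⟨body, .mul u v⟩
        (mul ((⟨body, .mul u v⟩ : PICircuit 𝔽 X).prefixAt u) ((⟨body, .mul u v⟩ : PICircuit 𝔽 X).prefixAt v))

/-- Both sides of a C1/C2 instance unfold to the same formula. [cite: HrubesTzameret2015, Remark 1.3] -/
theorem IsExtra.unfold_eq {s : PIAxiom} {F G : PICircuit 𝔽 X} (h : IsExtra s F G) :
    F.unfold = G.unfold := by
  cases h with
  | c1 body u v => exact unfold_eq_of_out_add body u v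
  | c2 body u v => exact unfold_eq_of_out_mul body u v

/-- C1/C2 instances rename to C1/C2 instances. [cite: HrubesTzameret2015, §1.1] -/
theorem IsExtra.rename (f : X → Y) {s : PIAxiom} {F G : PICircuit 𝔽 X} (h : IsExtra s F G) :
    IsExtra s (F.rename f) (G.rename f) := by
  cases h with
  | c1 body u v =>
    rw [rename_add, ← prefixAt_rename, ← prefixAt_rename]
    exact .c1 _ u v
  | c2 body u v =>
    rw [rename_mul, ← prefixAt_rename, ← prefixAt_rename]
    exact .c2 _ u v

end Unfold

section Semantics

variable [CommSemiring 𝔽]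

/-- The polynomial `F̂` computed by a circuit: the value of its unfolding (HT §1.1).
[cite: HrubesTzameret2015, §1.1] -/
def eval (C : PICircuit 𝔽 X) : MvPolynomial X 𝔽 := C.unfold.eval

/-- `x̂ = x`. [cite: HrubesTzameret2015, §1.1] -/
@[simp] theorem eval_var (x : X) : (var x : PICircuit 𝔽 X).eval = MvPolynomial.X x := rfl
/-- `ĉ = c`. [cite: HrubesTzameret2015, §1.1] -/
@[simp] theorem eval_const (c : 𝔽) : (const c : PICircuit 𝔽 X).eval = C c := rfl
/-- `(F + G)^ = F̂ + Ĝ`. [cite: HrubesTzameret2015, §1.1] -/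
@[simp] theorem eval_add (F G : PICircuit 𝔽 X) : (add F G).eval = F.eval + G.eval := by
  simp [eval]
/-- `(F · G)^ = F̂ · Ĝ`. [cite: HrubesTzameret2015, §1.1] -/
@[simp] theorem eval_mul (F G : PICircuit 𝔽 X) : (mul F G).eval = F.eval * G.eval := by
  simp [eval]
/-- Renaming the leaves renames the computed polynomial. [cite: HrubesTzameret2015, §1.1] -/
@[simp] theorem eval_rename (f : X → Y) (C : PICircuit 𝔽 X) :
    (C.rename f).eval = MvPolynomial.rename f C.eval := by
  simp [eval]

end Semantics

end PICircuit

namespace PIFormula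

variable {𝔽 : Type u} {X : Type v}

/-- A formula as a circuit (HT §1.1: formulas are the circuits whose nodes have out-degree one),
in post-order straight-line presentation. [cite: HrubesTzameret2015, §1.1] -/
def toCircuit : PIFormula 𝔽 X → PICircuit 𝔽 X
  | var x => PICircuit.var x
  | const c => PICircuit.const c
  | add F G => PICircuit.add F.toCircuit G.toCircuit
  | mul F G => PICircuit.mul F.toCircuit G.toCircuit

/-- The circuit of a formula has the same size. [cite: HrubesTzameret2015, §1.1] -/
@[simp] theorem size_toCircuit (F : PIFormula 𝔽 X) : F.toCircuit.size = F.size := by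
  induction F <;> simp [toCircuit, *]

/-- The circuit of a formula unfolds to the formula. [cite: HrubesTzameret2015, Remark 1.3] -/
@[simp] theorem unfold_toCircuit [Zero 𝔽] (F : PIFormula 𝔽 X) : F.toCircuit.unfold = F := by
  induction F <;> simp [toCircuit, *]

/-- The circuit of a formula computes the same polynomial. [cite: HrubesTzameret2015, §1.1] -/
@[simp] theorem eval_toCircuit [CommSemiring 𝔽] (F : PIFormula 𝔽 X) : F.toCircuit.eval = F.eval := by
  simp [PICircuit.eval]

end PIFormula

/-! ### Equational proof systems: lines, axioms, rules, proofs, measures -/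

/-- The data of an equational proof system for polynomial identities over constants `𝔽` on a
term language `T` (formulas for `P_f`, circuits for `P_c`; HT §1.1): the sum `F + G` and product
`F · G` of terms (on disjoint copies), the constant terms, the EXTRA axiom schemes beyond A1–A10
(none for `P_f`; C1, C2 for `P_c`), and the size of a term. [cite: HrubesTzameret2015, §1.1] -/
structure PISystem (𝔽 : Type u) (T : Type w) : Type (max u w) where
  /-- the term `F + G` -/
  add : T → T → T
  /-- the term `F · G` -/
  mul : T → T → T
  /-- the one-node term labelled by a constant -/
  cst : 𝔽 → T
  /-- the extra axiom schemes (instances of scheme `s` with sides `F`, `G`) -/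
  Extra : PIAxiom → T → T → Prop
  /-- the size of a term -/
  size : T → ℕ

namespace PISystem

variable {𝔽 : Type u} {T : Type w} {T' : Type v}

/-- The axiom schemes A1–A10 of `P_f(𝔽)` / `P_c(𝔽)` exactly as printed (HT §1.1): A1 `F = F`,
A2 `F + G = G + F`, A3 `F + (G + H) = (F + G) + H`, A4 `F·G = G·F`, A5 `F·(G·H) = (F·G)·H`,
A6 `F·(G + H) = F·G + F·H`, A7 `F + 0 = F`, A8 `F·0 = 0`, A9 `F·1 = F`, A10 `a = b + c` and
`a' = b'·c'` for constants whenever the equation holds in `𝔽`. Axioms apply to whole sides of a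
line. [cite: HrubesTzameret2015, §1.1] -/
inductive RingAxiom [CommSemiring 𝔽] (S : PISystem 𝔽 T) : PIAxiom → T → T → Prop
  /-- A1 `F = F` -/
  | a1 (F : T) : RingAxiom S .A1 F F
  /-- A2 `F + G = G + F` -/
  | a2 (F G : T) : RingAxiom S .A2 (S.add F G) (S.add G F)
  /-- A3 `F + (G + H) = (F + G) + H` -/
  | a3 (F G H : T) : RingAxiom S .A3 (S.add F (S.add G H)) (S.add (S.add F G) H)
  /-- A4 `F · G = G · F` -/
  | a4 (F G : T) : RingAxiom S .A4 (S.mul F G) (S.mul G F)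
  /-- A5 `F · (G · H) = (F · G) · H` -/
  | a5 (F G H : T) : RingAxiom S .A5 (S.mul F (S.mul G H)) (S.mul (S.mul F G) H)
  /-- A6 `F · (G + H) = F · G + F · H` -/
  | a6 (F G H : T) : RingAxiom S .A6 (S.mul F (S.add G H)) (S.add (S.mul F G) (S.mul F H))
  /-- A7 `F + 0 = F` -/
  | a7 (F : T) : RingAxiom S .A7 (S.add F (S.cst 0)) F
  /-- A8 `F · 0 = 0` -/
  | a8 (F : T) : RingAxiom S .A8 (S.mul F (S.cst 0)) (S.cst 0)
  /-- A9 `F · 1 = F` -/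
  | a9 (F : T) : RingAxiom S .A9 (S.mul F (S.cst 1)) F
  /-- A10 `a = b + c` whenever this holds in `𝔽` -/
  | a10_add (a b c : 𝔽) (h : a = b + c) : RingAxiom S .A10 (S.cst a) (S.add (S.cst b) (S.cst c))
  /-- A10 `a' = b' · c'` whenever this holds in `𝔽` -/
  | a10_mul (a b c : 𝔽) (h : a = b * c) : RingAxiom S .A10 (S.cst a) (S.mul (S.cst b) (S.cst c))

/-- `F = G` is an instance of axiom scheme `s` of the system `S`: one of A1–A10, or one of the
extra schemes of `S` (C1, C2 for `P_c`) (HT §1.1). [cite: HrubesTzameret2015, §1.1] -/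
def IsAxiom [CommSemiring 𝔽] (S : PISystem 𝔽 T) (s : PIAxiom) (F G : T) : Prop :=
  S.RingAxiom s F G ∨ S.Extra s F G

/-- The size of a list of lines: the sum over all lines `F = G` of `|F| + |G|` (HT §1.1).
[cite: HrubesTzameret2015, §1.1] -/
def linesSize (size : T → ℕ) (Γ : List (T × T)) : ℕ :=
  (Γ.map fun e => size e.1 + size e.2).sum

/-- Unfolding of `linesSize`. [cite: HrubesTzameret2015, §1.1] -/
@[simp] theorem linesSize_nil (size : T → ℕ) : linesSize size [] = 0 := rfl

/-- Unfolding of `linesSize`. [cite: HrubesTzameret2015, §1.1] -/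
@[simp] theorem linesSize_cons (size : T → ℕ) (e : T × T) (Γ : List (T × T)) :
    linesSize size (e :: Γ) = size e.1 + size e.2 + linesSize size Γ := by
  simp [linesSize]

end PISystem

/-- A PROOF in the equational system `S` (HT §1.1: "a sequence of equations `F₁ = G₁, …,
F_k = G_k` such that every equation is either an axiom or was obtained from previous equations
by one of the rules R1–R4"), indexed by its list of lines, LAST LINE FIRST: the empty proof;
a proof extended by an axiom instance (`axm`, recording the scheme); or a proof extended by a
line obtained from EARLIER lines (members of `Γ`) by R1 (`symm`: from `F = G` infer `G = F`),
R2 (`trans`: from `F = G`, `G = H` infer `F = H`), R3 (`addRule`: from `F₁ = G₁`, `F₂ = G₂`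
infer `F₁ + F₂ = G₁ + G₂`) or R4 (`mulRule`, likewise for `·`). A proof OF `F = G` is a proof
with index `(F, G) :: Γ`. [cite: HrubesTzameret2015, §1.1] -/
inductive PIProof {𝔽 : Type u} {T : Type w} [CommSemiring 𝔽] (S : PISystem 𝔽 T) :
    List (T × T) → Type (max u w)
  /-- the empty sequence -/
  | nil : PIProof S []
  /-- append an instance `F = G` of axiom scheme `s` -/
  | axm {Γ : List (T × T)} (s : PIAxiom) {F G : T} (h : S.IsAxiom s F G) (π : PIProof S Γ) :
      PIProof S ((F, G) :: Γ)
  /-- R1: from an earlier line `F = G` infer `G = F` -/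
  | symm {Γ : List (T × T)} {F G : T} (h : (F, G) ∈ Γ) (π : PIProof S Γ) : PIProof S ((G, F) :: Γ)
  /-- R2: from earlier lines `F = G` and `G = H` infer `F = H` -/
  | trans {Γ : List (T × T)} {F G H : T} (h₁ : (F, G) ∈ Γ) (h₂ : (G, H) ∈ Γ) (π : PIProof S Γ) :
      PIProof S ((F, H) :: Γ)
  /-- R3: from earlier lines `F₁ = G₁` and `F₂ = G₂` infer `F₁ + F₂ = G₁ + G₂` -/
  | addRule {Γ : List (T × T)} {F₁ G₁ F₂ G₂ F G : T} (h₁ : (F₁, G₁) ∈ Γ) (h₂ : (F₂, G₂) ∈ Γ)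
      (hF : F = S.add F₁ F₂) (hG : G = S.add G₁ G₂) (π : PIProof S Γ) : PIProof S ((F, G) :: Γ)
  /-- R4: from earlier lines `F₁ = G₁` and `F₂ = G₂` infer `F₁ · F₂ = G₁ · G₂` -/
  | mulRule {Γ : List (T × T)} {F₁ G₁ F₂ G₂ F G : T} (h₁ : (F₁, G₁) ∈ Γ) (h₂ : (F₂, G₂) ∈ Γ)
      (hF : F = S.mul F₁ F₂) (hG : G = S.mul G₁ G₂) (π : PIProof S Γ) : PIProof S ((F, G) :: Γ)

namespace PIProof

variable {𝔽 : Type u} {T : Type w} [CommSemiring 𝔽] {S : PISystem 𝔽 T}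

/-- The lines of a proof, in the order they were derived. [cite: HrubesTzameret2015, §1.1] -/
def lines {Γ : List (T × T)} (_π : PIProof S Γ) : List (T × T) := Γ.reverse

/-- The NUMBER OF LINES of a proof (HT §1.1). [cite: HrubesTzameret2015, §1.1] -/
def lineCount {Γ : List (T × T)} (_π : PIProof S Γ) : ℕ := Γ.length

/-- The SIZE of a proof: the sum over all its lines `F_i = G_i` of `|F_i| + |G_i|` (HT §1.1).
[cite: HrubesTzameret2015, §1.1] -/
def size {Γ : List (T × T)} (_π : PIProof S Γ) : ℕ := PISystem.linesSize S.size Γ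

/-- The number of lines of a proof introduced as instances of the axiom scheme `s` (the measure
behind axiom-metered budgets such as "at most `t` instances of A6"). [cite: HrubesTzameret2015, §1.1] -/
def axiomCount (s : PIAxiom) : {Γ : List (T × T)} → PIProof S Γ → ℕ
  | _, nil => 0
  | _, axm s' _ π => π.axiomCount s + if s' = s then 1 else 0
  | _, symm _ π => π.axiomCount s
  | _, trans _ _ π => π.axiomCount s
  | _, addRule _ _ _ _ π => π.axiomCount s
  | _, mulRule _ _ _ _ π => π.axiomCount s

/-- The maximal `d`-value (e.g. depth) of a side of a line of the proof (HT §1.1: the depth of a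
`P_c` proof is the maximal depth of a circuit appearing in it). [cite: HrubesTzameret2015, §1.1] -/
def maxMeasure (d : T → ℕ) {Γ : List (T × T)} (_π : PIProof S Γ) : ℕ :=
  (Γ.map fun e => max (d e.1) (d e.2)).foldr max 0

/-- The size of the empty proof is `0`. [cite: HrubesTzameret2015, §1.1] -/
@[simp] theorem size_nil : (nil : PIProof S []).size = 0 := rfl

/-- The size of a proof only depends on its lines. [cite: HrubesTzameret2015, §1.1] -/
theorem size_eq {Γ : List (T × T)} (π : PIProof S Γ) : π.size = PISystem.linesSize S.size Γ := rfl

/-- The number of lines only depends on the lines. [cite: HrubesTzameret2015, §1.1] -/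
theorem lineCount_eq {Γ : List (T × T)} (π : PIProof S Γ) : π.lineCount = Γ.length := rfl

/-- Each side of each line of a proof is smaller than the proof. [cite: HrubesTzameret2015, §1.1] -/
theorem size_add_size_le_size {Γ : List (T × T)} (π : PIProof S Γ) {F G : T} (h : (F, G) ∈ Γ) :
    S.size F + S.size G ≤ π.size := by
  rw [size_eq]
  clear π
  induction Γ with
  | nil => simp at h
  | cons e Γ ih =>
    rw [PISystem.linesSize_cons]
    rcases List.mem_cons.1 h with rfl | h
    · exact Nat.le_add_right _ _
    · exact (ih h).trans (Nat.le_add_left _ _)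

/-- A proof has at least as many lines as instances of any one axiom scheme.
[cite: HrubesTzameret2015, §1.1] -/
theorem axiomCount_le_lineCount (s : PIAxiom) {Γ : List (T × T)} (π : PIProof S Γ) :
    π.axiomCount s ≤ π.lineCount := by
  induction π with
  | nil => simp [axiomCount, lineCount]
  | axm s' h π ih => simp only [axiomCount, lineCount, List.length_cons] at *; split <;> omega
  | symm _ π ih => simp only [axiomCount, lineCount, List.length_cons] at *; omega
  | trans _ _ π ih => simp only [axiomCount, lineCount, List.length_cons] at *; omega
  | addRule _ _ _ _ π ih => simp only [axiomCount, lineCount, List.length_cons] at *; omega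
  | mulRule _ _ _ _ π ih => simp only [axiomCount, lineCount, List.length_cons] at *; omega

/-- Concatenation of proofs: the steps of `π₂` carried out after those of `π₁` (every line
of `π₁` stays available as an earlier line). [cite: HrubesTzameret2015, §1.1] -/
def append {Γ₁ : List (T × T)} (π₁ : PIProof S Γ₁) : {Γ₂ : List (T × T)} → PIProof S Γ₂ →
    PIProof S (Γ₂ ++ Γ₁)
  | _, nil => π₁
  | _, axm s h π => axm s h (π₁.append π)
  | _, symm h π => symm (List.mem_append_left Γ₁ h) (π₁.append π)
  | _, trans h₁ h₂ π => trans (List.mem_append_left Γ₁ h₁) (List.mem_append_left Γ₁ h₂) (π₁.append π)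
  | _, addRule h₁ h₂ hF hG π =>
    addRule (List.mem_append_left Γ₁ h₁) (List.mem_append_left Γ₁ h₂) hF hG (π₁.append π)
  | _, mulRule h₁ h₂ hF hG π =>
    mulRule (List.mem_append_left Γ₁ h₁) (List.mem_append_left Γ₁ h₂) hF hG (π₁.append π)

/-- The size of a concatenation is the sum of the sizes. [cite: HrubesTzameret2015, §1.1] -/
@[simp] theorem size_append {Γ₁ Γ₂ : List (T × T)} (π₁ : PIProof S Γ₁) (π₂ : PIProof S Γ₂) :
    (π₁.append π₂).size = π₂.size + π₁.size := by
  simp [size_eq, PISystem.linesSize, List.sum_append]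

/-- The number of lines of a concatenation is the sum. [cite: HrubesTzameret2015, §1.1] -/
@[simp] theorem lineCount_append {Γ₁ Γ₂ : List (T × T)} (π₁ : PIProof S Γ₁) (π₂ : PIProof S Γ₂) :
    (π₁.append π₂).lineCount = π₂.lineCount + π₁.lineCount := by
  simp [lineCount]

/-- Axiom counts of a concatenation add up. [cite: HrubesTzameret2015, §1.1] -/
@[simp] theorem axiomCount_append (s : PIAxiom) {Γ₁ Γ₂ : List (T × T)} (π₁ : PIProof S Γ₁)
    (π₂ : PIProof S Γ₂) : (π₁.append π₂).axiomCount s = π₂.axiomCount s + π₁.axiomCount s := by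
  induction π₂ with
  | nil => simp [append, axiomCount]
  | axm s' h π ih => simp only [append, axiomCount, ih]; omega
  | symm _ π ih => simp [append, axiomCount, ih]
  | trans _ _ π ih => simp [append, axiomCount, ih]
  | addRule _ _ _ _ π ih => simp [append, axiomCount, ih]
  | mulRule _ _ _ _ π ih => simp [append, axiomCount, ih]

/-- The one-line proof consisting of an axiom instance. [cite: HrubesTzameret2015, §1.1] -/
@[simp] theorem axiomCount_axm_nil (s s' : PIAxiom) {F G : T} (h : S.IsAxiom s' F G) :
    (axm s' h nil).axiomCount s = if s' = s then 1 else 0 := by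
  simp [axiomCount]

section Soundness

variable {A : Type*} [CommSemiring A]

/-- The axioms A1–A10 are sound for any semantics into a commutative semiring that turns `+`,
`·` and constants into `+`, `·` and (the images of) constants (HT Prop. 1.1, soundness half).
[cite: HrubesTzameret2015, Prop. 1.1] -/
theorem _root_.Literature.Computability.AlgebraicComplexity.PISystem.RingAxiom.sound
    (ev : T → A) (φ : 𝔽 →+* A)
    (h_add : ∀ a b, ev (S.add a b) = ev a + ev b) (h_mul : ∀ a b, ev (S.mul a b) = ev a * ev b)
    (h_cst : ∀ c, ev (S.cst c) = φ c) {s : PIAxiom} {F G : T} (h : S.RingAxiom s F G) :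
    ev F = ev G := by
  cases h with
  | a1 F => rfl
  | a2 F G => rw [h_add, h_add, add_comm]
  | a3 F G H => rw [h_add, h_add, h_add, h_add, add_assoc]
  | a4 F G => rw [h_mul, h_mul, mul_comm]
  | a5 F G H => rw [h_mul, h_mul, h_mul, h_mul, mul_assoc]
  | a6 F G H => rw [h_mul, h_add, h_add, h_mul, h_mul, mul_add]
  | a7 F => rw [h_add, h_cst, map_zero, add_zero]
  | a8 F => rw [h_mul, h_cst, map_zero, mul_zero]
  | a9 F => rw [h_mul, h_cst, map_one, mul_one]
  | a10_add a b c h => rw [h_add, h_cst, h_cst, h_cst, h, map_add]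
  | a10_mul a b c h => rw [h_mul, h_cst, h_cst, h_cst, h, map_mul]

/-- SOUNDNESS (HT Prop. 1.1, "⇒", "easily proved by induction on the number of lines"): for a
semantics `ev` into a commutative semiring compatible with `+`, `·`, constants and the extra
axioms, both sides of every line of a proof have the same value. [cite: HrubesTzameret2015, Prop. 1.1] -/
theorem sound (ev : T → A) (φ : 𝔽 →+* A)
    (h_add : ∀ a b, ev (S.add a b) = ev a + ev b) (h_mul : ∀ a b, ev (S.mul a b) = ev a * ev b)
    (h_cst : ∀ c, ev (S.cst c) = φ c) (h_extra : ∀ s F G, S.Extra s F G → ev F = ev G)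
    {Γ : List (T × T)} (π : PIProof S Γ) : ∀ {F G : T}, (F, G) ∈ Γ → ev F = ev G := by
  induction π with
  | nil => intro F G h; simp at h
  | axm s hax π ih =>
    intro F G h
    rcases List.mem_cons.1 h with h | h
    · obtain ⟨rfl, rfl⟩ := Prod.mk.injEq _ _ _ _ ▸ h
      rcases hax with hax | hax
      · exact hax.sound ev φ h_add h_mul h_cst
      · exact h_extra _ _ _ hax
    · exact ih h
  | symm hm π ih =>
    intro F G h
    rcases List.mem_cons.1 h with h | h
    · obtain ⟨rfl, rfl⟩ := Prod.mk.injEq _ _ _ _ ▸ h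
      exact (ih hm).symm
    · exact ih h
  | trans h₁ h₂ π ih =>
    intro F G h
    rcases List.mem_cons.1 h with h | h
    · obtain ⟨rfl, rfl⟩ := Prod.mk.injEq _ _ _ _ ▸ h
      exact (ih h₁).trans (ih h₂)
    · exact ih h
  | addRule h₁ h₂ hF hG π ih =>
    intro F G h
    rcases List.mem_cons.1 h with h | h
    · obtain ⟨rfl, rfl⟩ := Prod.mk.injEq _ _ _ _ ▸ h
      rw [hF, hG, h_add, h_add, ih h₁, ih h₂]
    · exact ih h
  | mulRule h₁ h₂ hF hG π ih =>
    intro F G h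
    rcases List.mem_cons.1 h with h | h
    · obtain ⟨rfl, rfl⟩ := Prod.mk.injEq _ _ _ _ ▸ h
      rw [hF, hG, h_mul, h_mul, ih h₁, ih h₂]
    · exact ih h

end Soundness

end PIProof

/-! ### Morphisms of systems: renaming, substitution, `P_f ⊆ P_c` -/

namespace PISystem

variable {𝔽 : Type u} {T : Type w} {T' : Type v}

/-- A morphism of proof systems: a map of term languages commuting with `+`, `·` and constants
and sending extra axiom instances to extra axiom instances of the same scheme. Renamings
`X → Y`, substitutions `F ↦ F(z/H)` and the inclusion of formulas into circuits are morphisms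
(HT §1.1: "proofs are closed under substitution"). [cite: HrubesTzameret2015, §1.1] -/
structure Hom (S : PISystem 𝔽 T) (S' : PISystem 𝔽 T') where
  /-- the map on terms -/
  toFun : T → T'
  /-- compatibility with `+` -/
  map_add (a b : T) : toFun (S.add a b) = S'.add (toFun a) (toFun b)
  /-- compatibility with `·` -/
  map_mul (a b : T) : toFun (S.mul a b) = S'.mul (toFun a) (toFun b)
  /-- compatibility with constants -/
  map_cst (c : 𝔽) : toFun (S.cst c) = S'.cst c
  /-- extra axiom instances go to extra axiom instances -/
  map_extra (s : PIAxiom) (F G : T) : S.Extra s F G → S'.Extra s (toFun F) (toFun G)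

variable {S : PISystem 𝔽 T} {S' : PISystem 𝔽 T'}

/-- The size of the image of a list of lines under a morphism of size factor `m`.
[cite: HrubesTzameret2015, §1.1] -/
theorem linesSize_map_le (φ : S.Hom S') (m : ℕ) (hm : ∀ a, S'.size (φ.toFun a) ≤ m * S.size a)
    (Γ : List (T × T)) :
    linesSize S'.size (Γ.map (Prod.map φ.toFun φ.toFun)) ≤ m * linesSize S.size Γ := by
  induction Γ with
  | nil => simp
  | cons e Γ ih =>
    simp only [List.map_cons, linesSize_cons, Prod.map_fst, Prod.map_snd, Nat.mul_add]
    exact Nat.add_le_add (Nat.add_le_add (hm _) (hm _)) ih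

variable [CommSemiring 𝔽]

/-- A morphism maps instances of A1–A10 to instances of the same scheme. [cite: HrubesTzameret2015, §1.1] -/
theorem RingAxiom.map (φ : S.Hom S') {s : PIAxiom} {F G : T} (h : S.RingAxiom s F G) :
    S'.RingAxiom s (φ.toFun F) (φ.toFun G) := by
  cases h with
  | a1 F => exact .a1 _
  | a2 F G => rw [φ.map_add, φ.map_add]; exact .a2 _ _
  | a3 F G H => rw [φ.map_add, φ.map_add, φ.map_add, φ.map_add]; exact .a3 _ _ _
  | a4 F G => rw [φ.map_mul, φ.map_mul]; exact .a4 _ _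
  | a5 F G H => rw [φ.map_mul, φ.map_mul, φ.map_mul, φ.map_mul]; exact .a5 _ _ _
  | a6 F G H => rw [φ.map_mul, φ.map_add, φ.map_add, φ.map_mul, φ.map_mul]; exact .a6 _ _ _
  | a7 F => rw [φ.map_add, φ.map_cst]; exact .a7 _
  | a8 F => rw [φ.map_mul, φ.map_cst]; exact .a8 _
  | a9 F => rw [φ.map_mul, φ.map_cst]; exact .a9 _
  | a10_add a b c h => rw [φ.map_add, φ.map_cst, φ.map_cst, φ.map_cst]; exact .a10_add _ _ _ h
  | a10_mul a b c h => rw [φ.map_mul, φ.map_cst, φ.map_cst, φ.map_cst]; exact .a10_mul _ _ _ h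

/-- A morphism maps axiom instances to axiom instances of the same scheme. [cite: HrubesTzameret2015, §1.1] -/
theorem IsAxiom.map (φ : S.Hom S') {s : PIAxiom} {F G : T} (h : S.IsAxiom s F G) :
    S'.IsAxiom s (φ.toFun F) (φ.toFun G) :=
  h.imp (RingAxiom.map φ) (φ.map_extra s F G)

end PISystem

namespace PIProof

variable {𝔽 : Type u} {T : Type w} {T' : Type v} [CommSemiring 𝔽] {S : PISystem 𝔽 T}
  {S' : PISystem 𝔽 T'}

/-- The image of a proof under a morphism of systems: the same sequence of steps on the mapped
lines (HT §1.1: "if `F₁ = G₁, …, F_k = G_k` is a proof then so is `F₁(z/H) = G₁(z/H), …`").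
[cite: HrubesTzameret2015, §1.1] -/
def map (φ : S.Hom S') : {Γ : List (T × T)} → PIProof S Γ →
    PIProof S' (Γ.map (Prod.map φ.toFun φ.toFun))
  | _, nil => nil
  | _, axm s h π => axm s (h.map φ) (π.map φ)
  | _, symm h π => symm (List.mem_map_of_mem h) (π.map φ)
  | _, trans h₁ h₂ π => trans (List.mem_map_of_mem h₁) (List.mem_map_of_mem h₂) (π.map φ)
  | _, addRule h₁ h₂ hF hG π =>
    addRule (List.mem_map_of_mem h₁) (List.mem_map_of_mem h₂)
      (by simp only [hF, φ.map_add]) (by simp only [hG, φ.map_add]) (π.map φ)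
  | _, mulRule h₁ h₂ hF hG π =>
    mulRule (List.mem_map_of_mem h₁) (List.mem_map_of_mem h₂)
      (by simp only [hF, φ.map_mul]) (by simp only [hG, φ.map_mul]) (π.map φ)

/-- A morphism preserves the number of lines. [cite: HrubesTzameret2015, §1.1] -/
@[simp] theorem lineCount_map (φ : S.Hom S') {Γ : List (T × T)} (π : PIProof S Γ) :
    (π.map φ).lineCount = π.lineCount := by
  simp [lineCount]

/-- A morphism preserves the number of instances of each axiom scheme. [cite: HrubesTzameret2015, §1.1] -/
@[simp] theorem axiomCount_map (φ : S.Hom S') (s : PIAxiom) {Γ : List (T × T)} (π : PIProof S Γ) :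
    (π.map φ).axiomCount s = π.axiomCount s := by
  induction π <;> simp [map, axiomCount, *]

/-- A morphism of size factor `m` multiplies the size of a proof by at most `m`.
[cite: HrubesTzameret2015, §1.1] -/
theorem size_map_le (φ : S.Hom S') (m : ℕ) (hm : ∀ a, S'.size (φ.toFun a) ≤ m * S.size a)
    {Γ : List (T × T)} (π : PIProof S Γ) : (π.map φ).size ≤ m * π.size :=
  PISystem.linesSize_map_le φ m hm Γ

end PIProof

/-! ### Provability within a size and an axiom budget -/

namespace PISystem

variable {𝔽 : Type u} {T : Type w} {T' : Type v} [CommSemiring 𝔽]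

/-- `S.Provable F G size budget`: the equation `F = G` has a proof in the system `S` of size at
most `size : ℕ∞` in which, for every scheme `s`, at most `budget s : ℕ∞` lines are instances of
`s` (`⊤` = unconstrained) (HT §1.1, proofs and their size; the axiom-metered form is the one
used by route ProofCarryingSymmetry). [cite: HrubesTzameret2015, §1.1] -/
def Provable (S : PISystem 𝔽 T) (F G : T) (size : ℕ∞) (budget : PIAxiom → ℕ∞) : Prop :=
  ∃ (Γ : List (T × T)) (π : PIProof S ((F, G) :: Γ)),
    (π.size : ℕ∞) ≤ size ∧ ∀ s, (π.axiomCount s : ℕ∞) ≤ budget s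

variable {S : PISystem 𝔽 T} {S' : PISystem 𝔽 T'}

/-- Monotonicity in the size and axiom budgets. [cite: HrubesTzameret2015, §1.1] -/
theorem Provable.mono {F G : T} {size size' : ℕ∞} {budget budget' : PIAxiom → ℕ∞}
    (h : S.Provable F G size budget) (hs : size ≤ size') (hb : ∀ s, budget s ≤ budget' s) :
    S.Provable F G size' budget' := by
  obtain ⟨Γ, π, h₁, h₂⟩ := h
  exact ⟨Γ, π, h₁.trans hs, fun s => (h₂ s).trans (hb s)⟩

/-- Soundness of provability (HT Prop. 1.1 "⇒"). [cite: HrubesTzameret2015, Prop. 1.1] -/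
theorem Provable.eval_eq {A : Type*} [CommSemiring A] (ev : T → A) (φ : 𝔽 →+* A)
    (h_add : ∀ a b, ev (S.add a b) = ev a + ev b) (h_mul : ∀ a b, ev (S.mul a b) = ev a * ev b)
    (h_cst : ∀ c, ev (S.cst c) = φ c) (h_extra : ∀ s F G, S.Extra s F G → ev F = ev G)
    {F G : T} {size : ℕ∞} {budget : PIAxiom → ℕ∞} (h : S.Provable F G size budget) :
    ev F = ev G := by
  obtain ⟨Γ, π, -, -⟩ := h
  exact π.sound ev φ h_add h_mul h_cst h_extra List.mem_cons_self

/-- Provability is transported along a morphism of size factor `m` (renaming: `m = 1`;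
substitution of `H`: `m = |H|`). [cite: HrubesTzameret2015, §1.1] -/
theorem Provable.map (φ : S.Hom S') (m : ℕ) (hm : ∀ a, S'.size (φ.toFun a) ≤ m * S.size a)
    {F G : T} {size : ℕ∞} {budget : PIAxiom → ℕ∞} (h : S.Provable F G size budget) :
    S'.Provable (φ.toFun F) (φ.toFun G) (m * size) budget := by
  obtain ⟨Γ, π, h₁, h₂⟩ := h
  have hsize : ((π.map φ).size : ℕ∞) ≤ m * size :=
    calc ((π.map φ).size : ℕ∞) ≤ ((m * π.size : ℕ) : ℕ∞) := ENat.coe_le_coe.2 (π.size_map_le φ m hm)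
      _ = (m : ℕ∞) * (π.size : ℕ∞) := Nat.cast_mul m π.size
      _ ≤ m * size := mul_le_mul_right h₁ _
  have hcount : ∀ s, ((π.map φ).axiomCount s : ℕ∞) ≤ budget s := fun s =>
    (ENat.coe_le_coe.2 (π.axiomCount_map φ s).le).trans (h₂ s)
  exact ⟨Γ.map (Prod.map φ.toFun φ.toFun), π.map φ, hsize, hcount⟩

/-- An axiom instance `F = G` of scheme `s` is a one-line proof of size `|F| + |G|` using one
instance of `s`. [cite: HrubesTzameret2015, §1.1] -/
theorem Provable.of_isAxiom {s : PIAxiom} {F G : T} (h : S.IsAxiom s F G) :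
    S.Provable F G (S.size F + S.size G : ℕ) (fun s' => if s = s' then 1 else 0) := by
  refine ⟨[], .axm s h .nil, by simp [PIProof.size_eq], fun s' => ?_⟩
  rw [PIProof.axiomCount_axm_nil]
  split <;> simp [*]

/-- A1: `F = F` is provable in one line. [cite: HrubesTzameret2015, §1.1] -/
theorem Provable.refl (F : T) :
    S.Provable F F (S.size F + S.size F : ℕ) (fun s => if PIAxiom.A1 = s then 1 else 0) :=
  Provable.of_isAxiom (.inl (.a1 F))

/-- R1: a proof of `F = G` extended by the line `G = F`. [cite: HrubesTzameret2015, §1.1] -/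
theorem Provable.symm {F G : T} {size : ℕ∞} {budget : PIAxiom → ℕ∞} (h : S.Provable F G size budget) :
    S.Provable G F (size + (S.size G + S.size F : ℕ)) budget := by
  obtain ⟨Γ, π, h₁, h₂⟩ := h
  refine ⟨(F, G) :: Γ, .symm List.mem_cons_self π, ?_, fun s => by simpa [PIProof.axiomCount] using h₂ s⟩
  simp only [PIProof.size_eq, linesSize_cons] at h₁ ⊢
  push_cast at h₁ ⊢
  rw [add_comm]
  exact add_le_add h₁ le_rfl

/-- R2: proofs of `F = G` and `G = H` concatenated and extended by the line `F = H`; sizes and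
axiom counts add up. [cite: HrubesTzameret2015, §1.1] -/
theorem Provable.trans {F G H : T} {size₁ size₂ : ℕ∞} {budget₁ budget₂ : PIAxiom → ℕ∞}
    (hFG : S.Provable F G size₁ budget₁) (hGH : S.Provable G H size₂ budget₂) :
    S.Provable F H (size₁ + size₂ + (S.size F + S.size H : ℕ)) (budget₁ + budget₂) := by
  obtain ⟨Γ₁, π₁, h₁, c₁⟩ := hFG
  obtain ⟨Γ₂, π₂, h₂, c₂⟩ := hGH
  refine ⟨((G, H) :: Γ₂) ++ ((F, G) :: Γ₁),
    .trans (List.mem_append_right _ List.mem_cons_self) (List.mem_append_left _ List.mem_cons_self)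
      (π₁.append π₂), ?_, fun s => ?_⟩
  · simp only [PIProof.size_eq, linesSize_cons] at h₁ h₂ ⊢
    have hsz := PIProof.size_append π₁ π₂
    simp only [PIProof.size_eq] at hsz
    rw [hsz]; push_cast at h₁ h₂ ⊢
    calc (S.size F : ℕ∞) + S.size H + (linesSize S.size ((G, H) :: Γ₂) + linesSize S.size ((F, G) :: Γ₁))
        = linesSize S.size ((F, G) :: Γ₁) + linesSize S.size ((G, H) :: Γ₂) + (S.size F + S.size H) := by
          simp only [linesSize_cons]; push_cast; ring
      _ ≤ size₁ + size₂ + (S.size F + S.size H) := by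
          gcongr
          · simpa [linesSize_cons] using h₁
          · simpa [linesSize_cons] using h₂
  · simp only [PIProof.axiomCount, PIProof.axiomCount_append, Nat.cast_add, Pi.add_apply]
    rw [add_comm]
    exact add_le_add (c₁ s) (c₂ s)

/-- R3: proofs of `F₁ = G₁` and `F₂ = G₂` concatenated and extended by the line
`F₁ + F₂ = G₁ + G₂`. [cite: HrubesTzameret2015, §1.1] -/
theorem Provable.add {F₁ G₁ F₂ G₂ : T} {size₁ size₂ : ℕ∞} {budget₁ budget₂ : PIAxiom → ℕ∞}
    (h₁ : S.Provable F₁ G₁ size₁ budget₁) (h₂ : S.Provable F₂ G₂ size₂ budget₂) :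
    S.Provable (S.add F₁ F₂) (S.add G₁ G₂)
      (size₁ + size₂ + (S.size (S.add F₁ F₂) + S.size (S.add G₁ G₂) : ℕ)) (budget₁ + budget₂) := by
  obtain ⟨Γ₁, π₁, hs₁, c₁⟩ := h₁
  obtain ⟨Γ₂, π₂, hs₂, c₂⟩ := h₂
  refine ⟨((F₂, G₂) :: Γ₂) ++ ((F₁, G₁) :: Γ₁),
    .addRule (List.mem_append_right _ List.mem_cons_self) (List.mem_append_left _ List.mem_cons_self)
      rfl rfl (π₁.append π₂), ?_, fun s => ?_⟩
  · have hsz := PIProof.size_append π₁ π₂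
    simp only [PIProof.size_eq] at hsz hs₁ hs₂ ⊢
    rw [linesSize_cons, hsz]
    push_cast
    calc (S.size (S.add F₁ F₂) : ℕ∞) + S.size (S.add G₁ G₂) +
          (linesSize S.size ((F₂, G₂) :: Γ₂) + linesSize S.size ((F₁, G₁) :: Γ₁))
        = linesSize S.size ((F₁, G₁) :: Γ₁) + linesSize S.size ((F₂, G₂) :: Γ₂) +
            (S.size (S.add F₁ F₂) + S.size (S.add G₁ G₂)) := by ring
      _ ≤ size₁ + size₂ + (S.size (S.add F₁ F₂) + S.size (S.add G₁ G₂)) := by gcongr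
  · simp only [PIProof.axiomCount, PIProof.axiomCount_append, Nat.cast_add, Pi.add_apply]
    rw [add_comm]
    exact add_le_add (c₁ s) (c₂ s)

/-- R4: proofs of `F₁ = G₁` and `F₂ = G₂` concatenated and extended by the line
`F₁ · F₂ = G₁ · G₂`. [cite: HrubesTzameret2015, §1.1] -/
theorem Provable.mul {F₁ G₁ F₂ G₂ : T} {size₁ size₂ : ℕ∞} {budget₁ budget₂ : PIAxiom → ℕ∞}
    (h₁ : S.Provable F₁ G₁ size₁ budget₁) (h₂ : S.Provable F₂ G₂ size₂ budget₂) :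
    S.Provable (S.mul F₁ F₂) (S.mul G₁ G₂)
      (size₁ + size₂ + (S.size (S.mul F₁ F₂) + S.size (S.mul G₁ G₂) : ℕ)) (budget₁ + budget₂) := by
  obtain ⟨Γ₁, π₁, hs₁, c₁⟩ := h₁
  obtain ⟨Γ₂, π₂, hs₂, c₂⟩ := h₂
  refine ⟨((F₂, G₂) :: Γ₂) ++ ((F₁, G₁) :: Γ₁),
    .mulRule (List.mem_append_right _ List.mem_cons_self) (List.mem_append_left _ List.mem_cons_self)
      rfl rfl (π₁.append π₂), ?_, fun s => ?_⟩
  · have hsz := PIProof.size_append π₁ π₂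
    simp only [PIProof.size_eq] at hsz hs₁ hs₂ ⊢
    rw [linesSize_cons, hsz]
    push_cast
    calc (S.size (S.mul F₁ F₂) : ℕ∞) + S.size (S.mul G₁ G₂) +
          (linesSize S.size ((F₂, G₂) :: Γ₂) + linesSize S.size ((F₁, G₁) :: Γ₁))
        = linesSize S.size ((F₁, G₁) :: Γ₁) + linesSize S.size ((F₂, G₂) :: Γ₂) +
            (S.size (S.mul F₁ F₂) + S.size (S.mul G₁ G₂)) := by ring
      _ ≤ size₁ + size₂ + (S.size (S.mul F₁ F₂) + S.size (S.mul G₁ G₂)) := by gcongr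
  · simp only [PIProof.axiomCount, PIProof.axiomCount_append, Nat.cast_add, Pi.add_apply]
    rw [add_comm]
    exact add_le_add (c₁ s) (c₂ s)

end PISystem

/-! ### The systems `P_f(𝔽)` and `P_c(𝔽)` -/

section Systems

variable (𝔽 : Type u) (X : Type v) {Y : Type w}

/-- The system `P_f(𝔽)` on formulas over `X`: `+`, `·` are the formula constructors, constants
are constant leaves, no extra axioms, size = number of nodes (HT §1.1). [cite: HrubesTzameret2015, §1.1] -/
def pfSystem : PISystem 𝔽 (PIFormula 𝔽 X) where
  add := .add
  mul := .mul
  cst := .const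
  Extra := fun _ _ _ => False
  size := PIFormula.size

/-- The system `P_c(𝔽)` on circuits over `X`: `+`, `·` on disjoint copies, constant leaves, the
extra axioms C1, C2, size = number of nodes (HT §1.1). [cite: HrubesTzameret2015, §1.1] -/
def pcSystem [Zero 𝔽] : PISystem 𝔽 (PICircuit 𝔽 X) where
  add := PICircuit.add
  mul := PICircuit.mul
  cst := PICircuit.const
  Extra := PICircuit.IsExtra
  size := PICircuit.size

variable [CommSemiring 𝔽]

/-- `P_f(𝔽)` proofs with lines `Γ` (last line first) (HT §1.1). [cite: HrubesTzameret2015, §1.1] -/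
abbrev PFProof (Γ : List (PIFormula 𝔽 X × PIFormula 𝔽 X)) : Type (max u v) :=
  PIProof (pfSystem 𝔽 X) Γ

/-- `P_c(𝔽)` proofs with lines `Γ` (last line first) (HT §1.1). [cite: HrubesTzameret2015, §1.1] -/
abbrev PCProof (Γ : List (PICircuit 𝔽 X × PICircuit 𝔽 X)) : Type (max u v) :=
  PIProof (pcSystem 𝔽 X) Γ

variable {𝔽 X}

/-- The DEPTH of a `P_c` proof: the maximal depth of a circuit appearing in it (HT §1.1).
[cite: HrubesTzameret2015, §1.1] -/
def PCProof.depth {Γ : List (PICircuit 𝔽 X × PICircuit 𝔽 X)} (π : PCProof 𝔽 X Γ) : ℕ :=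
  π.maxMeasure PICircuit.depth

/-- `F = G` has a `P_f(𝔽)` proof of size at most `s`. [cite: HrubesTzameret2015, §1.1] -/
def HasPFProofOfSize (F G : PIFormula 𝔽 X) (s : ℕ) : Prop :=
  (pfSystem 𝔽 X).Provable F G s ⊤

/-- `F = G` has a `P_c(𝔽)` proof of size at most `s`. [cite: HrubesTzameret2015, §1.1] -/
def HasPCProofOfSize (F G : PICircuit 𝔽 X) (s : ℕ) : Prop :=
  (pcSystem 𝔽 X).Provable F G s ⊤

/-- `F = G` has a `P_c(𝔽)` proof using, for each scheme `s`, at most `budget s` instances of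
`s` (axiom-metered provability; size unconstrained). [cite: HrubesTzameret2015, §1.1] -/
def HasPCProof (F G : PICircuit 𝔽 X) (budget : PIAxiom → ℕ∞) : Prop :=
  (pcSystem 𝔽 X).Provable F G ⊤ budget

/-- `F = G` has a `P_c(𝔽)` proof of size at most `size` within the axiom budget `budget`.
[cite: HrubesTzameret2015, §1.1] -/
def HasPCProofWithin (F G : PICircuit 𝔽 X) (size : ℕ∞) (budget : PIAxiom → ℕ∞) : Prop :=
  (pcSystem 𝔽 X).Provable F G size budget

/-- Unfolding `HasPFProofOfSize` to proofs. [cite: HrubesTzameret2015, §1.1] -/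
theorem hasPFProofOfSize_iff (F G : PIFormula 𝔽 X) (s : ℕ) :
    HasPFProofOfSize F G s ↔ ∃ (Γ : _) (π : PFProof 𝔽 X ((F, G) :: Γ)), π.size ≤ s := by
  simp [HasPFProofOfSize, PISystem.Provable]

/-- Unfolding `HasPCProofOfSize` to proofs. [cite: HrubesTzameret2015, §1.1] -/
theorem hasPCProofOfSize_iff (F G : PICircuit 𝔽 X) (s : ℕ) :
    HasPCProofOfSize F G s ↔ ∃ (Γ : _) (π : PCProof 𝔽 X ((F, G) :: Γ)), π.size ≤ s := by
  simp [HasPCProofOfSize, PISystem.Provable]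

/-- Unfolding `HasPCProof` to proofs. [cite: HrubesTzameret2015, §1.1] -/
theorem hasPCProof_iff (F G : PICircuit 𝔽 X) (budget : PIAxiom → ℕ∞) :
    HasPCProof F G budget ↔
      ∃ (Γ : _) (π : PCProof 𝔽 X ((F, G) :: Γ)), ∀ s, (π.axiomCount s : ℕ∞) ≤ budget s := by
  simp [HasPCProof, PISystem.Provable]

/-- A size-bounded proof is a proof within that size and no axiom budget. [cite: HrubesTzameret2015, §1.1] -/
theorem hasPCProofOfSize_iff_within (F G : PICircuit 𝔽 X) (s : ℕ) :
    HasPCProofOfSize F G s ↔ HasPCProofWithin F G s ⊤ := Iff.rfl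

/-- An axiom-metered proof is a proof within that budget and no size bound. [cite: HrubesTzameret2015, §1.1] -/
theorem hasPCProof_iff_within (F G : PICircuit 𝔽 X) (budget : PIAxiom → ℕ∞) :
    HasPCProof F G budget ↔ HasPCProofWithin F G ⊤ budget := Iff.rfl

/-! #### Soundness (HT Prop. 1.1, "⇒") -/

/-- Both sides of every line of a `P_f` proof compute the same polynomial. [cite: HrubesTzameret2015, Prop. 1.1] -/
theorem PFProof.eval_eq {Γ : List (PIFormula 𝔽 X × PIFormula 𝔽 X)} (π : PFProof 𝔽 X Γ)
    {F G : PIFormula 𝔽 X} (h : (F, G) ∈ Γ) : F.eval = G.eval :=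
  π.sound PIFormula.eval MvPolynomial.C (fun _ _ => rfl) (fun _ _ => rfl) (fun _ => rfl)
    (fun _ _ _ h => False.elim h) h

/-- Both sides of every line of a `P_c` proof compute the same polynomial. [cite: HrubesTzameret2015, Prop. 1.1] -/
theorem PCProof.eval_eq {Γ : List (PICircuit 𝔽 X × PICircuit 𝔽 X)} (π : PCProof 𝔽 X Γ)
    {F G : PICircuit 𝔽 X} (h : (F, G) ∈ Γ) : F.eval = G.eval :=
  π.sound PICircuit.eval MvPolynomial.C PICircuit.eval_add PICircuit.eval_mul (fun _ => rfl)
    (fun s F G (h : PICircuit.IsExtra s F G) => by simp only [PICircuit.eval, h.unfold_eq]) h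

/-- `P_f`-provable equations are identities. [cite: HrubesTzameret2015, Prop. 1.1] -/
theorem HasPFProofOfSize.eval_eq {F G : PIFormula 𝔽 X} {s : ℕ} (h : HasPFProofOfSize F G s) :
    F.eval = G.eval := by
  obtain ⟨Γ, π, -⟩ := (hasPFProofOfSize_iff F G s).1 h
  exact PFProof.eval_eq π List.mem_cons_self

/-- `P_c`-provable equations are identities. [cite: HrubesTzameret2015, Prop. 1.1] -/
theorem HasPCProofWithin.eval_eq {F G : PICircuit 𝔽 X} {size : ℕ∞} {budget : PIAxiom → ℕ∞}
    (h : HasPCProofWithin F G size budget) : F.eval = G.eval := by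
  obtain ⟨Γ, π, -, -⟩ := h
  exact PCProof.eval_eq π List.mem_cons_self

/-- `P_c`-provable equations are identities. [cite: HrubesTzameret2015, Prop. 1.1] -/
theorem HasPCProofOfSize.eval_eq {F G : PICircuit 𝔽 X} {s : ℕ} (h : HasPCProofOfSize F G s) :
    F.eval = G.eval :=
  HasPCProofWithin.eval_eq h

/-- `P_c`-provable equations are identities. [cite: HrubesTzameret2015, Prop. 1.1] -/
theorem HasPCProof.eval_eq {F G : PICircuit 𝔽 X} {budget : PIAxiom → ℕ∞} (h : HasPCProof F G budget) :
    F.eval = G.eval :=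
  HasPCProofWithin.eval_eq h

/-! #### Monotonicity -/

/-- Monotonicity in the size bound. [cite: HrubesTzameret2015, §1.1] -/
theorem HasPFProofOfSize.mono {F G : PIFormula 𝔽 X} {s s' : ℕ} (h : HasPFProofOfSize F G s)
    (hs : s ≤ s') : HasPFProofOfSize F G s' :=
  PISystem.Provable.mono h (by exact_mod_cast hs) fun _ => le_rfl

/-- Monotonicity in the size bound and the budget. [cite: HrubesTzameret2015, §1.1] -/
theorem HasPCProofWithin.mono {F G : PICircuit 𝔽 X} {size size' : ℕ∞} {budget budget' : PIAxiom → ℕ∞}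
    (h : HasPCProofWithin F G size budget) (hs : size ≤ size') (hb : ∀ s, budget s ≤ budget' s) :
    HasPCProofWithin F G size' budget' :=
  PISystem.Provable.mono h hs hb

/-- Monotonicity in the size bound. [cite: HrubesTzameret2015, §1.1] -/
theorem HasPCProofOfSize.mono {F G : PICircuit 𝔽 X} {s s' : ℕ} (h : HasPCProofOfSize F G s)
    (hs : s ≤ s') : HasPCProofOfSize F G s' :=
  PISystem.Provable.mono h (by exact_mod_cast hs) fun _ => le_rfl

/-- Monotonicity in the budget. [cite: HrubesTzameret2015, §1.1] -/
theorem HasPCProof.mono {F G : PICircuit 𝔽 X} {budget budget' : PIAxiom → ℕ∞} (h : HasPCProof F G budget)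
    (hb : ∀ s, budget s ≤ budget' s) : HasPCProof F G budget' :=
  PISystem.Provable.mono h le_rfl hb

/-- Forgetting the budget. [cite: HrubesTzameret2015, §1.1] -/
theorem HasPCProofWithin.hasPCProofOfSize {F G : PICircuit 𝔽 X} {s : ℕ} {budget : PIAxiom → ℕ∞}
    (h : HasPCProofWithin F G s budget) : HasPCProofOfSize F G s :=
  PISystem.Provable.mono h le_rfl fun _ => le_top

/-- Forgetting the size. [cite: HrubesTzameret2015, §1.1] -/
theorem HasPCProofWithin.hasPCProof {F G : PICircuit 𝔽 X} {size : ℕ∞} {budget : PIAxiom → ℕ∞}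
    (h : HasPCProofWithin F G size budget) : HasPCProof F G budget :=
  PISystem.Provable.mono h le_top fun _ => le_rfl

/-! #### Closure under renaming, substitution, and `P_f ⊆ P_c` -/

/-- Renaming formulas along `f : X → Y` is a morphism `P_f(𝔽)[X] → P_f(𝔽)[Y]`. [cite: HrubesTzameret2015, §1.1] -/
def PIFormula.renameHom (f : X → Y) : (pfSystem 𝔽 X).Hom (pfSystem 𝔽 Y) where
  toFun := PIFormula.rename f
  map_add _ _ := rfl
  map_mul _ _ := rfl
  map_cst _ := rfl
  map_extra _ _ _ h := h.elim

/-- Simultaneous substitution is a morphism `P_f(𝔽)[X] → P_f(𝔽)[Y]`. [cite: HrubesTzameret2015, §1.1] -/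
def PIFormula.bindHom (τ : X → PIFormula 𝔽 Y) : (pfSystem 𝔽 X).Hom (pfSystem 𝔽 Y) where
  toFun := PIFormula.bind τ
  map_add _ _ := rfl
  map_mul _ _ := rfl
  map_cst _ := rfl
  map_extra _ _ _ h := h.elim

/-- Formulas into circuits is a morphism `P_f(𝔽) → P_c(𝔽)`. [cite: HrubesTzameret2015, §1.1] -/
def PIFormula.toCircuitHom : (pfSystem 𝔽 X).Hom (pcSystem 𝔽 X) where
  toFun := PIFormula.toCircuit
  map_add _ _ := rfl
  map_mul _ _ := rfl
  map_cst _ := rfl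
  map_extra _ _ _ h := h.elim

/-- Renaming circuits along `f : X → Y` is a morphism `P_c(𝔽)[X] → P_c(𝔽)[Y]`. [cite: HrubesTzameret2015, §1.1] -/
def PICircuit.renameHom (f : X → Y) : (pcSystem 𝔽 X).Hom (pcSystem 𝔽 Y) where
  toFun := PICircuit.rename f
  map_add := PICircuit.rename_add f
  map_mul := PICircuit.rename_mul f
  map_cst _ := rfl
  map_extra s F G (h : PICircuit.IsExtra s F G) := h.rename f

/-- `P_f` proofs are closed under renaming of the variables, with the same size (HT §1.1).
[cite: HrubesTzameret2015, §1.1] -/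
theorem HasPFProofOfSize.rename (f : X → Y) {F G : PIFormula 𝔽 X} {s : ℕ} (h : HasPFProofOfSize F G s) :
    HasPFProofOfSize (F.rename f) (G.rename f) s := by
  have := PISystem.Provable.map (PIFormula.renameHom f) 1
    (fun a => by simp [PIFormula.renameHom, pfSystem]) h
  simpa [HasPFProofOfSize, PIFormula.renameHom] using this

/-- `P_f` proofs are closed under substitution `F(z/H)`, the size growing by the factor `|H|`
(HT §1.1: "proofs are closed under substitution"). [cite: HrubesTzameret2015, §1.1] -/
theorem HasPFProofOfSize.subst [DecidableEq X] (z : X) (H : PIFormula 𝔽 X) {F G : PIFormula 𝔽 X} {s : ℕ}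
    (h : HasPFProofOfSize F G s) : HasPFProofOfSize (F.subst z H) (G.subst z H) (H.size * s) := by
  have := PISystem.Provable.map (PIFormula.bindHom (Function.update PIFormula.var z H)) H.size
    (fun a => PIFormula.size_subst_le a z H) h
  simpa [PIFormula.bindHom, HasPFProofOfSize, PIFormula.subst] using this

/-- `P_f` proofs are closed under simultaneous substitution by formulas of size `≤ m`, the size
growing by the factor `m` (HT §1.1). [cite: HrubesTzameret2015, §1.1] -/
theorem HasPFProofOfSize.bind (τ : X → PIFormula 𝔽 Y) (m : ℕ) (hm : 1 ≤ m) (hτ : ∀ x, (τ x).size ≤ m)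
    {F G : PIFormula 𝔽 X} {s : ℕ} (h : HasPFProofOfSize F G s) :
    HasPFProofOfSize (F.bind τ) (G.bind τ) (m * s) := by
  have := PISystem.Provable.map (PIFormula.bindHom τ) m (fun a => PIFormula.size_bind_le τ m hm hτ a) h
  simpa [PIFormula.bindHom, HasPFProofOfSize] using this

/-- `P_c` extends `P_f`: a `P_f` proof is a `P_c` proof of the same size on the formulas read
as circuits (HT §1.1). [cite: HrubesTzameret2015, §1.1] -/
theorem HasPFProofOfSize.toCircuit {F G : PIFormula 𝔽 X} {s : ℕ} (h : HasPFProofOfSize F G s) :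
    HasPCProofOfSize F.toCircuit G.toCircuit s := by
  have := PISystem.Provable.map (PIFormula.toCircuitHom (𝔽 := 𝔽) (X := X)) 1
    (fun a => by simp [PIFormula.toCircuitHom, pfSystem, pcSystem]) h
  simpa [HasPCProofOfSize, HasPFProofOfSize, PIFormula.toCircuitHom] using this

/-- `P_c` proofs are closed under renaming of the variables, with the same size and the same
axiom counts (HT §1.1; the route relabels `x_ij ↦ x_{τ i, τ j}`). [cite: HrubesTzameret2015, §1.1] -/
theorem HasPCProofWithin.rename (f : X → Y) {F G : PICircuit 𝔽 X} {size : ℕ∞} {budget : PIAxiom → ℕ∞}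
    (h : HasPCProofWithin F G size budget) : HasPCProofWithin (F.rename f) (G.rename f) size budget := by
  have := PISystem.Provable.map (PICircuit.renameHom f) 1
    (fun a => by simp [PICircuit.renameHom, pcSystem]) h
  simpa [HasPCProofWithin, PICircuit.renameHom] using this

/-- `P_c` proofs are closed under renaming, with the same size. [cite: HrubesTzameret2015, §1.1] -/
theorem HasPCProofOfSize.rename (f : X → Y) {F G : PICircuit 𝔽 X} {s : ℕ} (h : HasPCProofOfSize F G s) :
    HasPCProofOfSize (F.rename f) (G.rename f) s :=
  HasPCProofWithin.rename f h

/-- Axiom-metered `P_c` proofs are closed under renaming, with the same budget. [cite: HrubesTzameret2015, §1.1] -/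
theorem HasPCProof.rename (f : X → Y) {F G : PICircuit 𝔽 X} {budget : PIAxiom → ℕ∞} (h : HasPCProof F G budget) :
    HasPCProof (F.rename f) (G.rename f) budget :=
  HasPCProofWithin.rename f h

end Systems

end Literature.Computability.AlgebraicComplexity
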